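import Mathlib
import Literature.MathematicalPhysics.QuantumFieldTheory.Balaban1983to89.B6BondElimination

/-!
# `Balaban1983to89.B15TreeGraph196` — [Balaban1989LargeFieldI] pp. 195–196: the tree graph `T = ⋃_{x∈P₁∖P₂} Γ_{y,x}`
# of the generalized axial gauge in a rectangular annulus `P₁ ∖ P₂` — GRAPH reading, PROVED: «the union of all the
# contours is a tree graph T on P₁∖P₂», `|T| + 1 = |P₁∖P₂|`, and the nesting property under enlarging `P₂`

statement-level skeleton of published theorems with citation tags; proofs where landed; nothing here is a claim about
the Yang–Mills mass gap.

CITATION HEADER (lean-in-tree rule 2026-08-18).  T. Bałaban, *Large field renormalization. I. The basic step of the 𝐑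
operation*, Commun. Math. Phys. **122**, 175–202 (1989), doi:10.1007/BF01257412, bib `Balaban1989LargeFieldI` (cell
paper B15).  PDF held: `paper:balaban1989-cmp122-large-field-i` (journal page = PDF page + 174); every quotation below
was READ AS AN IMAGE on the x2 renders `run/shared/lean/pub/pub-balaban/b2b-balaban-ref1/pages/1989-cmp122-large-field-I/
…-p021-x2.png, …-p022-x2.png` (pp. 195–196), not on the OCR layer.  WHAT IS REPRODUCED: SKELETON row `B15.Def@196`
(the tree gauge `T₀` of pp. 195–196 — this module: its building block, the tree `T` of ONE pair `P₁ ⊃ P₂`), unit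
`lit-balaban-r12` gen 3 (reader/typer of block B15), HOME `run/shared/lean/pub/lit-balaban/` (rows:
`lit-balaban-r12/ROWS-B15.md`).  Companion (TRANSPORT reading of the same page — contours as words, the gauge
transformation `v(x) = V(Γ_{y,x})`, `V^v(Γ) = 1`): seat p26's `B15TreeGauge196*` modules; the two readings are meant to
be bridged by «bond set of the word `Γ_{y,x}` = `contour`» once both are in the tree.

WHAT IS PRINTED (p. 195 bottom – p. 196, verbatim).  *"We fix a gauge which is a modification and a generalization of the
axial gauge in cubes used in the previous papers. At this point we make an essential use of the fact that the domains
Λ ⊃ Z″_k ⊃ ⋯ ⊃ Z″_{h+1} ⊃ (Ω″^{∼2}_{h+1})^c are rectangular parallelepipeds. … Consider two successive rectangular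
parallelepipeds in the sequence, for example P₁ = [a₁, b₁] × ⋯ × [a_d, b_d] ⊃ P₂ = [a′₁, b′₁] × ⋯ × [a′_d, b′_d], hence
[a′_μ, b′_μ] ⊂ [a_μ, b_μ]. We have to fix a gauge in P₁∖P₂, more precisely in the intersection with the corresponding
lattice. We may assume, rescaling properly, that it is the unit lattice. The gauge is fixed by a tree graph built of
bonds contained in P₁∖P₂. We fix the initial point y = (y₁, …, y_d) = (a₁ + 1/2, …, a_d + 1/2), and a number
a ∈ (a′₁, b′₁). For a given point x of the lattice in P₁∖P₂ we choose a contour connecting x to y. If x₁ ≤ a, then we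
take the usual contour Γ_{y,x} = [y, (y₁, …, y_{d−1}, x_d)] ∪ ⋯ ∪ [(y₁, x₂, …, x_d), x]. If x₁ > a, then we take the
contour Γ_{y,x} = [y, (y₁, …, y_{d−1}, x_d)] ∪ ⋯ ∪ [(y₁, y₂, y₃, x₄, …, x_d), (y₁, y₂, x₃, x₄, …, x_d)] ∪ [(y₁, y₂, x₃,
…, x_d), (b₁ − 1/2, y₂, x₃, …, x_d)] ∪ [(b₁ − 1/2, y₂, x₃, …, x_d), (b₁ − 1/2, x₂, x₃, …, x_d)] ∪ [(b₁ − 1/2, x₂, x₃, …,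
x_d), x]. This slightly awkward definition describes a simplest family of contours connecting points of P₁∖P₂ with
the point y. The union of all the contours is a tree graph T on P₁∖P₂, hence T = ⋃_{x∈P₁∖P₂} Γ_{y,x}. This definition
has the important property that if we enlarge P₂, i.e., we replace it by a rectangular parallelepiped P′₂, P₂ ⊂ P′₂ ⊂
P₁, and we remove the contours corresponding to points of P′₂∖P₂, then the remaining contours build the corresponding
graph T′ on P₁∖P′₂. We fix the gauge putting the bond variables equal to 1 for bonds belonging to the tree graph. We
use all gauge degrees of freedom connected with points of P₁∖P₂, except one, so we add an external bond to the
graph."*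

WHAT THIS MODULE DOES (kernel-checked; no `sorry`, axioms of `tree_isTree` = {propext, Classical.choice, Quot.sound}).
§2 the carrier: lattice points `LPt n = Fin (n+2) → ℤ` of `ℤ^d`, `d = n + 2 ≥ 2` (print `d = 4`; the two distinguished
directions `e₁, e₂` of print are the indices `0, 1`), unit bonds `(z, μ) = ⟨z, z + e_μ⟩` in the convention of
`B6BondElimination` (`unitVec`), boxes `box l u` = the lattice points of `[a, b]` (the points `a_μ + 1/2, …, b_μ − 1/2`
renamed `l_μ, …, u_μ`, so `y = l`) and the annulus `ann l u l′ u′ = P₁∖P₂`.  §3 the printed objects as DEFINITIONS: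
`usual l x` (the usual contour, as its set of unit bonds), `detour l u x` (the contour for `x₁ > a`, leg by leg),
`contour l u a x` (the case split; `a : ℤ` = the largest lattice coordinate `≤` the printed real `a`), `tree l u l′ u′ a
= ⋃_{x∈P₁∖P₂} Γ_{y,x}` and the graph `bondGraph T V` on the points of `V` whose edges are the bonds of `T` (Mathlib
`SimpleGraph`).  §4–§5 the structure of `T` made explicit: every point `z ≠ y` of `P₁∖P₂` has a predecessor `par z` on
its own contour, and `T` IS the set of the bonds `{z, par z}` (`tree_eq_image`; both inclusions are the leg-by-leg
bookkeeping of the printed contours), with a strictly decreasing rank — whence (§1, a folklore lemma proved here: a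
rooted parent structure spans a tree) the PRINTED CLAIMS, §6: `tree_isTree` («the union of all the contours is a tree
graph T on P₁∖P₂»: `(bondGraph (tree …) (ann …)).IsTree`), `tree_ends_mem` (every bond of `T` joins two lattice points
of `P₁∖P₂` — «built of bonds contained in P₁∖P₂»), `card_tree` (`|T| + 1 = |P₁∖P₂|` — «all gauge degrees of freedom
connected with points of P₁∖P₂, except one»), `tree_enlarge` / `tree_mono` / `Adm.enlarge` (the nesting property:
with the same `y` and `a` the contours do not depend on `P₂`, so deleting the contours of the points of `P′₂∖P₂`
leaves exactly `T′`, again a tree), and the DICTIONARY `usual_eq_contour`: inside a cube the usual contour is the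
contour (1.7) of [Balaban1984PropagatorsI] as typed in `B6BondElimination.contour` («the axial gauge in cubes used in
the previous papers»).  §7: the hypotheses are satisfiable (an explicit `d = 2` instance).

v1.1 (same unit, APPEND-ONLY: every declaration of §1–§7 unchanged from v1 = p244540; this docstring updated): §8 adds the folklore GLUING lemma (a tree
attached by one bond from its root to any vertex of a disjoint tree is a tree — private, in the rooted form of §1)
and the SINGLE-SCALE MODEL of the printed `T₀` over a chain `P^0 ⊃ ⋯ ⊃ P^m` (`Chain`, `layer`, `extBond`, `sites`,
`T0`), PROVED: `T0_isTree` («It is a tree graph in 𝔹₀»), `card_T0`/`card_T0_eq` (`|T₀|` = the number of sites of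
`P^0 ∖ P^m` — «fixing completely a gauge in this set»); scope caveat (iii) below is thereby reduced to the
multi-scale aspect recorded in §8.

v1.2 (same unit, APPEND-ONLY: every declaration of §1–§8 unchanged from v1.1 = p244776; this docstring updated): §9
removes that last residual.  In print the layers `P^i ∖ P^{i+1}` live on lattices of DIFFERENT scales («they are
L-bonds for the unit scale in P₁») and the external bond of `P₂ = P^i`, «[(a′₁ − 1/2, a′₂ + 1/2, …, a′_d + 1/2),
(a′₁ + 1/2, a′₂ + 1/2, …, a′_d + 1/2)]», joins a point of the coarser layer to a point of the finer layer which is in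
general NOT the initial point `y` of that layer's tree.  §9a proves the folklore RE-ROOTING lemma (a rooted parent
structure re-rooted at any of its vertices — the path to the old root reversed — is again one, with the same edges;
private), §9b an abstract bridge for bond sets recorded as ordered pairs of tagged points, §9c the MULTI-SCALE MODEL:
sites = the layers, each an admissible annulus in its OWN coordinates, tagged by the layer index (`MPt`, `mlayer`,
`msites`), bonds = the tagged trees of §3 and the external bonds `mext i = ⟨u_i, c_i⟩` between parameter points
`u_i ∈ P^{i−1} ∖ P^i`, `c_i ∈ P^i ∖ P^{i+1}` (print's two cube centres; their position is immaterial for the tree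
property, so it is not fixed here) plus the `Λ`-bond `⟨y − e₁, y⟩` (`MChain`, `MT0`), PROVED: `MT0_isTree` («It is a
tree graph in 𝔹₀»), `card_MT0` / `card_MT0_eq` / `card_MT0_eq_sum` (`|T₀| = Σ_i |P^i ∖ P^{i+1}|` — «fixing completely a
gauge in this set»), and `Chain.toMChain` (the single-scale model of §8 is the special case `u_{i} = l^{i} − e₁`,
`c_i = l^i`); an explicit two-lattice `d = 2` instance shows `MChain` satisfiable.  What remains outside this module of
row `B15.Def@196` is only the measure-level `δ_{T₀}(V′)` (landed separately: `B15TreeGaugeFixing196`, p248779) and the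
bound «|V′ − 1| < O(1)M²NR_k⁴ε_k» (row `B15.Claim@196`).

v1.3 (same unit, APPEND-ONLY: every declaration of §1–§9 unchanged from v1.2 = p249208; this docstring updated): §10
adds the ALGEBRAIC content of «We fix the gauge putting the bond variables equal to 1 for bonds belonging to the tree
graph. We use all gauge degrees of freedom connected with points of P₁∖P₂, except one» and «fixing completely a gauge
in this set», for an arbitrary group `G` acting by `V^g(b) = g(b₋)V(b)g(b₊)⁻¹`: EXISTENCE of a gauge transformation,
normalized at the root, putting any configuration to `1` on every bond of the tree, and UNIQUENESS given the value at
the root — `tree_gaugeFix_exists`/`_unique` (T, root `y`), `T0_gaugeFix_exists`/`_unique` (single-scale T₀),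
`MT0_gaugeFix_exists`/`_unique` (multi-scale T₀; root = the outer end `y − e₁` of the `Λ`-bond, outside `𝔅₀`), via two
private folklore lemmas on rooted parent structures (solve / compare down the ranks).

HYPOTHESES / HONEST SCOPE.  (i) The tree property is proved under `Adm l u l′ u′ a`: `P₁ ∋ y`; `P₂` stays off the faces
`x₁ = a₁`, `x₁ = b₁`, `x₂ = a₂` of `P₁` (`l 0 < l′ 0`, `u′ 0 < u 0`, `l 1 < l′ 1`); `a′₁ − 1 ≤ a ≤ b′₁ − 1/2` in lattice
units (`l′ 0 ≤ a + 1`, `a ≤ u′ 0`, i.e. print's `a ∈ (a′₁, b′₁)`).  Print states only «P₂ ⊂ P₁»; in the application the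
successive domains are separated by a layer of `M`-cubes (p. 179), so the separations hold there.  Each of the five
inequalities is NECESSARY already for the contours to stay inside `P₁∖P₂` (two-dimensional counterexamples, e.g.
`P₁ = [0,6]²`: with `P₂ = [2,3]×[0,2]` touching the face `x₂ = a₂` the first detour leg, which runs on the line
`x₂ = y₂`, crosses `P₂`; seat record `lit-balaban-r12`, gen 3); `P₂ ⊆ P₁` itself is not needed.  (ii) Contours are
typed as SETS of unit bonds (what «putting the bond variables equal to 1 for bonds belonging to the tree graph» uses);
as a path the printed detour contour backtracks when `x₂ = y₂` — immaterial here; the orientation / parallel transport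
along `Γ_{y,x}` is the companion (p26) reading.  (iii) NOT in this module (v1; for v1.1 see §8: the external bonds and the multi-layer union `T₀`
are now typed and proved a tree in the SINGLE-SCALE model — in print the layers of `Λ ⊃ Z″_k ⊃ ⋯` live on lattices
of different scales, «L-bonds for the unit scale in P₁», which is NOT modelled in §8; v1.2 §9 models it — tagged layers
on their own lattices, `MT0_isTree`): the Faddeev–Popov `δ_{T₀}(V′)`, and the bound «|V′ − 1| < O(1)M²NR_k⁴ε_k» (row `B15.Claim@196`,
`B15.PrelimIntegrations.IneqV196`).  (iv) Dimension `d ≥ 2` is needed for the detour to exist; nothing else of print's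
`d = 4` is used.  Value = a kernel-checked combinatorial lemma of the paper's gauge-fixing geometry; NOT summit progress.
-/

open Finset

namespace Literature.MathematicalPhysics.QuantumFieldTheory.Balaban1983to89.B15TreeGraph196

open B6BondElimination (unitVec unitVec_apply)

/-! ## §1  A rooted parent structure on a finite vertex set spans a tree (folklore bookkeeping) -/

section Rooted

variable {α : Type*}

/-- A ROOTED PARENT STRUCTURE on a finite vertex set `V`: a root `r ∈ V`, a parent map `p` sending every non-root
vertex of `V` into `V`, and a rank `φ` strictly decreasing along `p`. [folklore] -/
private structure RootedOn (V : Finset α) (r : α) (p : α → α) (φ : α → ℕ) : Prop where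
  root_mem : r ∈ V
  parent_mem : ∀ z ∈ V, z ≠ r → p z ∈ V
  rank_lt : ∀ z ∈ V, z ≠ r → φ (p z) < φ z

/-- The graph on `V` whose edges are the parent edges `{z, p z}`, `z ∈ V ∖ {r}`. [folklore] -/
private def parentGraph (V : Finset α) (r : α) (p : α → α) : SimpleGraph ↥V :=
  SimpleGraph.fromRel fun v w : ↥V => (v : α) ≠ r ∧ p v = w

/-- Adjacency in the parent graph. [folklore] -/
private theorem parentGraph_adj {V : Finset α} {r : α} {p : α → α} {v w : ↥V} :
    (parentGraph V r p).Adj v w ↔ v ≠ w ∧ (((v : α) ≠ r ∧ p v = w) ∨ ((w : α) ≠ r ∧ p w = v)) := by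
  rw [parentGraph, SimpleGraph.fromRel_adj]

namespace RootedOn

variable {V : Finset α} {r : α} {p : α → α} {φ : α → ℕ}

section NoDec

/-- No vertex is its own parent. [folklore] -/
private theorem parent_ne (h : RootedOn V r p φ) {z : α} (hz : z ∈ V) (hzr : z ≠ r) : p z ≠ z := by
  intro e
  have := h.rank_lt z hz hzr
  rw [e] at this
  exact lt_irrefl _ this

/-- No two vertices are each other's parents. [folklore] -/
private theorem no_two_cycle (h : RootedOn V r p φ) {z z' : α} (hz : z ∈ V) (hzr : z ≠ r) (hz' : z' ∈ V)
    (hz'r : z' ≠ r) (h1 : p z = z') (h2 : p z' = z) : False := by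
  have a := h.rank_lt z hz hzr
  have b := h.rank_lt z' hz' hz'r
  rw [h1] at a
  rw [h2] at b
  omega

/-- The parent edges `{z, p z}`, `z ≠ r`, are pairwise distinct: the unordered pair determines `z`. [folklore] -/
private theorem eq_of_pair_eq (h : RootedOn V r p φ) {z z' : α} (hz : z ∈ V) (hzr : z ≠ r) (hz' : z' ∈ V)
    (hz'r : z' ≠ r) (hpair : (z = z' ∧ p z = p z') ∨ (z = p z' ∧ p z = z')) : z = z' := by
  rcases hpair with ⟨e, -⟩ | ⟨e1, e2⟩
  · exact e
  · exact (h.no_two_cycle hz hzr hz' hz'r e2 e1.symm).elim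

/-- Every vertex is joined to the root along parent edges. [folklore] -/
private theorem reachable (h : RootedOn V r p φ) (v : ↥V) :
    (parentGraph V r p).Reachable ⟨r, h.root_mem⟩ v := by
  suffices H : ∀ k : ℕ, ∀ v : ↥V, φ v < k → (parentGraph V r p).Reachable ⟨r, h.root_mem⟩ v from
    H _ v (Nat.lt_succ_self _)
  intro k
  induction k with
  | zero => intro v hv; exact absurd hv (Nat.not_lt_zero _)
  | succ k ih =>
    intro v hv
    by_cases hvr : (v : α) = r
    · have : v = ⟨r, h.root_mem⟩ := Subtype.ext hvr
      rw [this]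
    · set w : ↥V := ⟨p v, h.parent_mem _ v.2 hvr⟩ with hw
      have hlt : φ (w : α) < φ v := h.rank_lt _ v.2 hvr
      have hreach := ih w (by omega)
      have hadj : (parentGraph V r p).Adj w v := by
        rw [parentGraph_adj]
        refine ⟨?_, Or.inr ⟨hvr, rfl⟩⟩
        intro e
        have e' : p v = v := by
          have := congrArg Subtype.val e
          simpa [hw] using this
        exact h.parent_ne v.2 hvr e'
      exact hreach.trans hadj.reachable

/-- The parent graph is connected. [folklore] -/
private theorem connected (h : RootedOn V r p φ) : (parentGraph V r p).Connected := by
  haveI : Nonempty ↥V := ⟨⟨r, h.root_mem⟩⟩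
  exact SimpleGraph.Connected.mk fun v w => (h.reachable v).symm.trans (h.reachable w)

end NoDec

section Dec

variable [DecidableEq α]

/-- A vertex of `V ∖ {r}` seen in `V`. [folklore] -/
private def vtx (z : ↥(V.erase r)) : ↥V := ⟨(z : α), (Finset.mem_erase.1 z.2).2⟩

/-- The parent of a vertex of `V ∖ {r}`, seen in `V`. [folklore] -/
private def pvtx (h : RootedOn V r p φ) (z : ↥(V.erase r)) : ↥V :=
  ⟨p z, h.parent_mem _ (Finset.mem_erase.1 z.2).2 (Finset.mem_erase.1 z.2).1⟩

/-- Coercion of `vtx`. [folklore] -/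
@[simp] private theorem coe_vtx (z : ↥(V.erase r)) : ((vtx z : ↥V) : α) = z := rfl

/-- Coercion of `pvtx`. [folklore] -/
@[simp] private theorem coe_pvtx (h : RootedOn V r p φ) (z : ↥(V.erase r)) : ((h.pvtx z : ↥V) : α) = p z := rfl

/-- A vertex of `V ∖ {r}` is adjacent to its parent. [folklore] -/
private theorem adj_vtx_pvtx (h : RootedOn V r p φ) (z : ↥(V.erase r)) :
    (parentGraph V r p).Adj (vtx z) (h.pvtx z) := by
  rw [parentGraph_adj]
  refine ⟨?_, Or.inl ⟨(Finset.mem_erase.1 z.2).1, rfl⟩⟩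
  intro e
  exact h.parent_ne (Finset.mem_erase.1 z.2).2 (Finset.mem_erase.1 z.2).1 (congrArg Subtype.val e).symm

/-- The parent edge of a non-root vertex, as an element of the edge set. [folklore] -/
private def edgeOf (h : RootedOn V r p φ) (z : ↥(V.erase r)) : (parentGraph V r p).edgeSet :=
  ⟨s(vtx z, h.pvtx z), (SimpleGraph.mem_edgeSet _).2 (h.adj_vtx_pvtx z)⟩

/-- The parent edge as an unordered pair. [folklore] -/
private theorem coe_edgeOf (h : RootedOn V r p φ) (z : ↥(V.erase r)) :
    ((h.edgeOf z : (parentGraph V r p).edgeSet) : Sym2 ↥V) = s(vtx z, h.pvtx z) := rfl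

/-- The parent edges are in bijection with the non-root vertices. [folklore] -/
private theorem edgeOf_bijective (h : RootedOn V r p φ) : Function.Bijective h.edgeOf := by
  constructor
  · intro z z' e
    have e1 : s(vtx z, h.pvtx z) = s(vtx z', h.pvtx z') := congrArg Subtype.val e
    rw [Sym2.eq_iff] at e1
    have hz := Finset.mem_erase.1 z.2
    have hz' := Finset.mem_erase.1 z'.2
    refine Subtype.ext (h.eq_of_pair_eq hz.2 hz.1 hz'.2 hz'.1 ?_)
    rcases e1 with ⟨a, b⟩ | ⟨a, b⟩
    · have a' := congrArg Subtype.val a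
      have b' := congrArg Subtype.val b
      simp only [coe_vtx, coe_pvtx] at a' b'
      exact Or.inl ⟨a', b'⟩
    · have a' := congrArg Subtype.val a
      have b' := congrArg Subtype.val b
      simp only [coe_vtx, coe_pvtx] at a' b'
      exact Or.inr ⟨a', b'⟩
  · rintro ⟨e, he⟩
    revert he
    refine Sym2.ind (fun v w => ?_) e
    intro he
    have hadj := (SimpleGraph.mem_edgeSet (parentGraph V r p)).1 he
    rw [parentGraph_adj] at hadj
    obtain ⟨-, ⟨hvr, hpv⟩ | ⟨hwr, hpw⟩⟩ := hadj
    · refine ⟨⟨v, Finset.mem_erase.2 ⟨hvr, v.2⟩⟩, Subtype.ext ?_⟩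
      have h1 : vtx ⟨(v : α), Finset.mem_erase.2 ⟨hvr, v.2⟩⟩ = v := Subtype.ext rfl
      have h2 : h.pvtx ⟨(v : α), Finset.mem_erase.2 ⟨hvr, v.2⟩⟩ = w := Subtype.ext hpv
      rw [coe_edgeOf, h1, h2]
    · refine ⟨⟨w, Finset.mem_erase.2 ⟨hwr, w.2⟩⟩, Subtype.ext ?_⟩
      have h1 : vtx ⟨(w : α), Finset.mem_erase.2 ⟨hwr, w.2⟩⟩ = w := Subtype.ext rfl
      have h2 : h.pvtx ⟨(w : α), Finset.mem_erase.2 ⟨hwr, w.2⟩⟩ = v := Subtype.ext hpw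
      rw [coe_edgeOf, h1, h2, Sym2.eq_swap]

/-- `|E| + 1 = |V|` for the parent graph. [folklore] -/
private theorem card_edgeSet (h : RootedOn V r p φ) :
    Nat.card (parentGraph V r p).edgeSet + 1 = V.card := by
  rw [← Nat.card_congr (Equiv.ofBijective _ h.edgeOf_bijective), Nat.card_eq_fintype_card,
    Fintype.card_coe, Finset.card_erase_of_mem h.root_mem]
  have : 0 < V.card := Finset.card_pos.2 ⟨r, h.root_mem⟩
  omega

/-- A rooted parent structure spans a TREE. [folklore] -/
private theorem isTree (h : RootedOn V r p φ) : (parentGraph V r p).IsTree := by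
  rw [SimpleGraph.isTree_iff_connected_and_card]
  refine ⟨h.connected, ?_⟩
  rw [h.card_edgeSet, Nat.card_eq_fintype_card, Fintype.card_coe]

end Dec

end RootedOn

end Rooted

/-! ## §2  The lattice carrier: points of `ℤ^d` (`d = n + 2 ≥ 2`), unit bonds `⟨z, z + e_μ⟩`, rectangular boxes -/

variable {n : ℕ}

/-- Lattice points of `ℤ^d`, `d = n + 2` (the construction needs the two distinguished directions `e₁, e₂` of
print, here the indices `0, 1`). [folklore] -/
abbrev LPt (n : ℕ) := Fin (n + 2) → ℤ

/-- Unit bonds `⟨z, z + e_μ⟩` recorded as `(z, μ)` (the convention of `B6BondElimination`). [folklore] -/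
abbrev LBond (n : ℕ) := LPt n × Fin (n + 2)

/-- The far end point `z + e_μ` of the bond `(z, μ)`. [folklore] -/
def LBond.hi (b : LBond n) : LPt n := b.1 + unitVec b.2

/-- Coordinates of `z + e_μ`. [folklore] -/
private theorem add_unitVec_self (z : LPt n) (μ : Fin (n + 2)) : (z + unitVec μ) μ = z μ + 1 := by
  simp [unitVec_apply]

/-- Coordinates of `z + e_μ`. [folklore] -/
private theorem add_unitVec_ne (z : LPt n) {μ i : Fin (n + 2)} (h : i ≠ μ) : (z + unitVec μ) i = z i := by
  simp [unitVec_apply, h]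

/-- Coordinates of `z − e_μ`. [folklore] -/
private theorem sub_unitVec_self (z : LPt n) (μ : Fin (n + 2)) : (z - unitVec μ) μ = z μ - 1 := by
  simp [unitVec_apply]

/-- Coordinates of `z − e_μ`. [folklore] -/
private theorem sub_unitVec_ne (z : LPt n) {μ i : Fin (n + 2)} (h : i ≠ μ) : (z - unitVec μ) i = z i := by
  simp [unitVec_apply, h]

/-! Small facts about the indices `0, 1` of `Fin (n + 2)` (print's directions `e₁, e₂`). -/

/-- `0 ≠ 1` in `Fin (n + 2)`. [folklore] -/
private theorem fin_zero_ne_one : (0 : Fin (n + 2)) ≠ 1 := by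
  intro e; have := congrArg Fin.val e; rw [Fin.val_zero, Fin.val_one] at this; omega

/-- No index is below `0`. [folklore] -/
private theorem not_lt_zero' (i : Fin (n + 2)) : ¬ i < 0 := by
  rw [Fin.lt_def, Fin.val_zero]; omega

/-- Indices above `0`. [folklore] -/
private theorem zero_lt_iff (i : Fin (n + 2)) : (0 : Fin (n + 2)) < i ↔ i ≠ 0 := by
  rw [Fin.lt_def, Fin.val_zero, Ne, Fin.ext_iff, Fin.val_zero]; omega

/-- Indices below `1`. [folklore] -/
private theorem lt_one_iff (i : Fin (n + 2)) : i < 1 ↔ i = 0 := by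
  rw [Fin.lt_def, Fin.val_one, Fin.ext_iff, Fin.val_zero]; omega

/-- Indices above `1`. [folklore] -/
private theorem one_lt_iff (i : Fin (n + 2)) : (1 : Fin (n + 2)) < i ↔ i ≠ 0 ∧ i ≠ 1 := by
  rw [Fin.lt_def, Fin.val_one, Ne, Ne, Fin.ext_iff, Fin.ext_iff, Fin.val_zero, Fin.val_one]; omega

/-- Indices `≥ 2`. [folklore] -/
private theorem two_le_iff (i : Fin (n + 2)) : 2 ≤ (i : ℕ) ↔ i ≠ 0 ∧ i ≠ 1 := by
  rw [Ne, Ne, Fin.ext_iff, Fin.ext_iff, Fin.val_zero, Fin.val_one]; omega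

/-- The rectangular parallelepiped (its lattice points) `P = {z : l_i ≤ z_i ≤ u_i}`; print: *"P₁ = [a₁, b₁] × ⋯ ×
[a_d, b_d]"* intersected with the unit lattice, the lattice points `a_μ + 1/2, …, b_μ − 1/2` being renamed
`l_μ, …, u_μ`. [cite: Balaban1989LargeFieldI, p.195] -/
noncomputable def box (l u : LPt n) : Finset (LPt n) :=
  Fintype.piFinset fun i => Finset.Icc (l i) (u i)

/-- Membership in a box is the printed pair of inequalities per coordinate. [cite: Balaban1989LargeFieldI, p.195] -/
theorem mem_box {l u z : LPt n} : z ∈ box l u ↔ ∀ i, l i ≤ z i ∧ z i ≤ u i := by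
  simp only [box, Fintype.mem_piFinset, Finset.mem_Icc]

/-- The lattice points of `P₁ ∖ P₂`. [cite: Balaban1989LargeFieldI, p.195] -/
noncomputable def ann (l u l' u' : LPt n) : Finset (LPt n) := box l u \ box l' u'

/-- Membership in `P₁ ∖ P₂`. [cite: Balaban1989LargeFieldI, p.195] -/
theorem mem_ann {l u l' u' z : LPt n} : z ∈ ann l u l' u' ↔ z ∈ box l u ∧ z ∉ box l' u' := Finset.mem_sdiff


/-- `Σ_i (z_i − l_i)` after a unit step forward. [folklore] -/
private theorem sum_sub_add_unitVec (z l : LPt n) (μ : Fin (n + 2)) :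
    ∑ i, ((z + unitVec μ) i - l i) = ∑ i, (z i - l i) + 1 := by
  have : ∀ i, (z + unitVec μ) i - l i = (z i - l i) + (if i = μ then 1 else 0) := by
    intro i; rw [Pi.add_apply, unitVec_apply]; ring
  simp_rw [this, Finset.sum_add_distrib, Finset.sum_ite_eq', Finset.mem_univ, if_true]

/-- `Σ_i (z_i − l_i)` after a unit step backward. [folklore] -/
private theorem sum_sub_sub_unitVec (z l : LPt n) (μ : Fin (n + 2)) :
    ∑ i, ((z - unitVec μ) i - l i) = ∑ i, (z i - l i) - 1 := by
  have : ∀ i, (z - unitVec μ) i - l i = (z i - l i) - (if i = μ then 1 else 0) := by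
    intro i; rw [Pi.sub_apply, unitVec_apply]; ring
  simp_rw [this, Finset.sum_sub_distrib, Finset.sum_ite_eq', Finset.mem_univ, if_true]

/-- `Σ_i (z_i − l_i) ≥ 0` in the box. [folklore] -/
private theorem sum_sub_nonneg {z l u : LPt n} (hz : z ∈ box l u) : 0 ≤ ∑ i, (z i - l i) :=
  Finset.sum_nonneg fun i _ => by have := (mem_box.1 hz i).1; omega

/-! ## §3  The contours `Γ_{y,x}` of p. 196, the tree `T = ⋃_{x ∈ P₁∖P₂} Γ_{y,x}`, and its graph -/

/-- The USUAL contour `Γ_{y,x}` (p. 196, case `x₁ ≤ a`), verbatim: *"If x₁ ≤ a, then we take the usual contour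
Γ_{y,x} = [y, (y₁, …, y_{d−1}, x_d)] ∪ ⋯ ∪ [(y₁, x₂, …, x_d), x]."* — as the set of its unit bonds `⟨w, w + e_μ⟩`:
the segment of direction `μ` consists of the bonds with `w_i = y_i (i < μ)`, `w_i = x_i (i > μ)`, `y_μ ≤ w_μ < x_μ`
(here `y = l`, the initial point; the coordinates are moved in the order `d, d−1, …, 1`, i.e. indices `n+1, …, 0`). It is
the contour (1.7) of [Balaban1984PropagatorsI] with the cube replaced by a box (`usual_eq_contour`).
[cite: Balaban1989LargeFieldI, p.196] -/
noncomputable def usual (l x : LPt n) : Finset (LBond n) :=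
  (box l x ×ˢ (Finset.univ : Finset (Fin (n + 2)))).filter fun b =>
    (∀ i, i < b.2 → b.1 i = l i) ∧ (∀ i, b.2 < i → b.1 i = x i) ∧ b.1 b.2 < x b.2

/-- Membership in the usual contour. [cite: Balaban1989LargeFieldI, p.196] -/
theorem mem_usual {l x : LPt n} {b : LBond n} :
    b ∈ usual l x ↔
      b.1 ∈ box l x ∧ (∀ i, i < b.2 → b.1 i = l i) ∧ (∀ i, b.2 < i → b.1 i = x i) ∧ b.1 b.2 < x b.2 := by
  simp only [usual, Finset.mem_filter, Finset.mem_product, Finset.mem_univ, and_true]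

/-- The DETOUR contour `Γ_{y,x}` (p. 196, case `x₁ > a`), verbatim: *"If x₁ > a, then we take the contour Γ_{y,x} =
[y, (y₁, …, y_{d−1}, x_d)] ∪ ⋯ ∪ [(y₁, y₂, y₃, x₄, …, x_d), (y₁, y₂, x₃, x₄, …, x_d)] ∪ [(y₁, y₂, x₃, …, x_d),
(b₁ − 1/2, y₂, x₃, …, x_d)] ∪ [(b₁ − 1/2, y₂, x₃, …, x_d), (b₁ − 1/2, x₂, x₃, …, x_d)] ∪ [(b₁ − 1/2, x₂, x₃, …, x_d), x]."*
— as the set of its unit bonds, leg by leg: (a) the segments of directions `d, …, 3` (indices `≥ 2`) as in the usual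
contour; (b) the first leg of direction `1` (index `0`) from `(y₁, y₂, x₃, …)` to the far face `x₁ = b₁ − 1/2 = u₀`;
(c) the leg of direction `2` (index `1`) on the far face; (d) the return leg of direction `1` from the far face back to
`x`. (As a path the contour may backtrack when `x₂ = y₂`; as a bond set this is immaterial.)
[cite: Balaban1989LargeFieldI, p.196] -/
noncomputable def detour (l u x : LPt n) : Finset (LBond n) :=
  (box l u ×ˢ (Finset.univ : Finset (Fin (n + 2)))).filter fun b =>
    (2 ≤ (b.2 : ℕ) ∧ (∀ i, i < b.2 → b.1 i = l i) ∧ (∀ i, b.2 < i → b.1 i = x i) ∧ b.1 b.2 < x b.2) ∨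
    (b.2 = 0 ∧ b.1 1 = l 1 ∧ (∀ i, 1 < i → b.1 i = x i) ∧ b.1 0 < u 0) ∨
    (b.2 = 1 ∧ b.1 0 = u 0 ∧ (∀ i, 1 < i → b.1 i = x i) ∧ b.1 1 < x 1) ∨
    (b.2 = 0 ∧ (∀ i, 0 < i → b.1 i = x i) ∧ x 0 ≤ b.1 0 ∧ b.1 0 < u 0)

/-- Membership in the detour contour. [cite: Balaban1989LargeFieldI, p.196] -/
theorem mem_detour {l u x : LPt n} {b : LBond n} :
    b ∈ detour l u x ↔ b.1 ∈ box l u ∧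
      ((2 ≤ (b.2 : ℕ) ∧ (∀ i, i < b.2 → b.1 i = l i) ∧ (∀ i, b.2 < i → b.1 i = x i) ∧ b.1 b.2 < x b.2) ∨
      (b.2 = 0 ∧ b.1 1 = l 1 ∧ (∀ i, 1 < i → b.1 i = x i) ∧ b.1 0 < u 0) ∨
      (b.2 = 1 ∧ b.1 0 = u 0 ∧ (∀ i, 1 < i → b.1 i = x i) ∧ b.1 1 < x 1) ∨
      (b.2 = 0 ∧ (∀ i, 0 < i → b.1 i = x i) ∧ x 0 ≤ b.1 0 ∧ b.1 0 < u 0)) := by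
  simp only [detour, Finset.mem_filter, Finset.mem_product, Finset.mem_univ, and_true]

/-- The contour `Γ_{y,x}` of p. 196: the usual one if `x₁ ≤ a`, the detour if `x₁ > a`; verbatim: *"We fix the initial
point y = (y₁, …, y_d) = (a₁ + 1/2, …, a_d + 1/2), and a number a ∈ (a′₁, b′₁). For a given point x of the lattice in
P₁∖P₂ we choose a contour connecting x to y."* (`a : ℤ` = the largest lattice coordinate `≤` the printed real `a`).
[cite: Balaban1989LargeFieldI, p.196] -/
noncomputable def contour (l u : LPt n) (a : ℤ) (x : LPt n) : Finset (LBond n) :=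
  if x 0 ≤ a then usual l x else detour l u x

/-- **The tree graph `T`** of p. 196, verbatim: *"The union of all the contours is a tree graph T on P₁∖P₂, hence
T = ⋃_{x∈P₁∖P₂} Γ_{y,x}."* — the union as a set of unit bonds (the tree PROPERTY is `tree_isTree`).
[cite: Balaban1989LargeFieldI, p.196] -/
noncomputable def tree (l u l' u' : LPt n) (a : ℤ) : Finset (LBond n) :=
  (ann l u l' u').biUnion (contour l u a)

/-- Membership in `T`. [cite: Balaban1989LargeFieldI, p.196] -/
theorem mem_tree {l u l' u' : LPt n} {a : ℤ} {b : LBond n} :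
    b ∈ tree l u l' u' a ↔ ∃ x ∈ ann l u l' u', b ∈ contour l u a x := Finset.mem_biUnion

/-- The graph on the lattice points `V` whose edges are the unit bonds of `T` joining two points of `V` — the object
of the printed phrase *"a tree graph T on P₁∖P₂"*. [cite: Balaban1989LargeFieldI, p.196] -/
def bondGraph (T : Finset (LBond n)) (V : Finset (LPt n)) : SimpleGraph ↥V :=
  SimpleGraph.fromRel fun v w : ↥V => ∃ b ∈ T, b.1 = v ∧ b.hi = w

/-- Adjacency in the graph of `T`: joined by a bond of `T`. [cite: Balaban1989LargeFieldI, p.196] -/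
theorem bondGraph_adj {T : Finset (LBond n)} {V : Finset (LPt n)} {v w : ↥V} :
    (bondGraph T V).Adj v w ↔
      v ≠ w ∧ ((∃ b ∈ T, b.1 = v ∧ b.hi = w) ∨ (∃ b ∈ T, b.1 = w ∧ b.hi = v)) := by
  rw [bondGraph, SimpleGraph.fromRel_adj]

/-- The HYPOTHESES on the pair `P₁ = [l, u] ⊃ P₂ = [l′, u′]` and the number `a` under which p. 196's construction is
carried out here (print: *"P₂ ⊂ P₁"*, *"a ∈ (a′₁, b′₁)"*; in the application the domains `Λ ⊃ Z″_k ⊃ ⋯` are separated by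
layers of `M`-cubes, p. 179): `P₁ ∋ y` is a box (`le`); `P₂` stays off the faces `x₁ = a₁` (`low₁`), `x₁ = b₁` (`high₁`)
and `x₂ = a₂` (`low₂`) of `P₁`; and `a′₁ − 1 ≤ a ≤ b′₁ − 1/2` in lattice units (`thr₁`, `thr₂`).  Each of `low₁`, `high₁`,
`low₂`, `thr₁`, `thr₂` is NECESSARY for the contours to stay inside `P₁∖P₂` (two-dimensional counterexamples otherwise;
seat record `lit-balaban-r12`).  `P₂ ⊆ P₁` itself is not needed. [cite: Balaban1989LargeFieldI, p.196] -/
structure Adm (l u l' u' : LPt n) (a : ℤ) : Prop where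
  le : ∀ i, l i ≤ u i
  low₁ : l 0 < l' 0
  high₁ : u' 0 < u 0
  low₂ : l 1 < l' 1
  thr₁ : l' 0 ≤ a + 1
  thr₂ : a ≤ u' 0

namespace Adm

variable {l u l' u' : LPt n} {a : ℤ}

/-- `y₁ ≤ a`. [cite: Balaban1989LargeFieldI, p.196] -/
theorem l_le_a (h : Adm l u l' u' a) : l 0 ≤ a := by have := h.low₁; have := h.thr₁; omega

/-- `a < u₁` (the far face lies beyond the threshold). [cite: Balaban1989LargeFieldI, p.196] -/
theorem a_lt_u (h : Adm l u l' u' a) : a < u 0 := by have := h.high₁; have := h.thr₂; omega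

/-- `y₁ < u₁`. [cite: Balaban1989LargeFieldI, p.196] -/
theorem l_lt_u (h : Adm l u l' u' a) : l 0 < u 0 := lt_of_le_of_lt h.l_le_a h.a_lt_u

/-- The initial point `y` lies in `P₁ ∖ P₂`. [cite: Balaban1989LargeFieldI, p.196] -/
theorem root_mem (h : Adm l u l' u' a) : l ∈ ann l u l' u' := by
  rw [mem_ann, mem_box, mem_box]
  refine ⟨fun i => ⟨le_rfl, h.le i⟩, fun H => ?_⟩
  have := (H 0).1; have := h.low₁; omega

end Adm

/-! ## §4  The parent structure of `T`: the lattice point preceding `z` on `Γ_{y,z}` -/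

/-- The first index at which `z` differs from `l` (junk `0` if `z = l`). [cite: Balaban1989LargeFieldI, p.196] -/
noncomputable def mIdx (l z : LPt n) : Fin (n + 2) :=
  if h : (Finset.univ.filter fun i => z i ≠ l i).Nonempty then (Finset.univ.filter fun i => z i ≠ l i).min' h else 0

/-- Defining property of `mIdx`. [folklore] -/
private theorem mIdx_spec {l z : LPt n} (hzl : z ≠ l) :
    z (mIdx l z) ≠ l (mIdx l z) ∧ ∀ i, i < mIdx l z → z i = l i := by
  have hne : (Finset.univ.filter fun i => z i ≠ l i).Nonempty := by
    by_contra hc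
    rw [Finset.not_nonempty_iff_eq_empty, Finset.filter_eq_empty_iff] at hc
    exact hzl (funext fun i => not_not.1 (hc (Finset.mem_univ i)))
  rw [mIdx, dif_pos hne]
  refine ⟨(Finset.mem_filter.1 (Finset.min'_mem _ hne)).2, fun i hi => ?_⟩
  by_contra hc
  exact absurd hi (not_lt.2 (Finset.min'_le _ _ (Finset.mem_filter.2 ⟨Finset.mem_univ i, hc⟩)))

/-- Characterization of `mIdx`. [folklore] -/
private theorem mIdx_eq {l z : LPt n} {m : Fin (n + 2)} (hm : z m ≠ l m) (hlt : ∀ i, i < m → z i = l i) :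
    mIdx l z = m := by
  have hzl : z ≠ l := fun e => hm (by rw [e])
  obtain ⟨h1, h2⟩ := mIdx_spec hzl
  rcases lt_trichotomy (mIdx l z) m with h | h | h
  · exact absurd (hlt _ h) h1
  · exact h
  · exact absurd (h2 _ h) hm

/-- The lattice point PRECEDING `z` on its contour `Γ_{y,z}` (p. 196), i.e. the parent of `z` in `T` rooted at `y = l`:
on the face `z₁ = y₁` the comb predecessor `z − e_m` (`m` the first index with `z_m ≠ y_m`); for `z₁ ≤ a`, and on the
line `z₂ = y₂` of the first detour leg, the point `z − e₁`; for `z₁ > a`, `z₂ ≠ y₂`: on the return leg `z + e₁`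
(`z₁ < u₁`), on the far face `z₁ = u₁` the point `z − e₂`. (Junk at `z = y`.) [cite: Balaban1989LargeFieldI, p.196] -/
noncomputable def par (l u : LPt n) (a : ℤ) (z : LPt n) : LPt n :=
  if z 0 = l 0 then z - unitVec (mIdx l z)
  else if z 0 ≤ a ∨ z 1 = l 1 then z - unitVec 0
  else if z 0 < u 0 then z + unitVec 0
  else z - unitVec 1

/-- The bond of `Γ_{y,z}` through which the contour enters `z` (the bond joining `z` to `par z`).
[cite: Balaban1989LargeFieldI, p.196] -/
noncomputable def pbond (l u : LPt n) (a : ℤ) (z : LPt n) : LBond n :=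
  if z 0 = l 0 then (z - unitVec (mIdx l z), mIdx l z)
  else if z 0 ≤ a ∨ z 1 = l 1 then (z - unitVec 0, 0)
  else if z 0 < u 0 then (z, 0)
  else (z - unitVec 1, 1)

section Cases

variable {l u : LPt n} {a : ℤ} {z : LPt n}

/-- Case of `par`. [folklore] -/
private theorem par_of_face (h0 : z 0 = l 0) : par l u a z = z - unitVec (mIdx l z) := by
  rw [par, if_pos h0]

/-- Case of `pbond`. [folklore] -/
private theorem pbond_of_face (h0 : z 0 = l 0) : pbond l u a z = (z - unitVec (mIdx l z), mIdx l z) := by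
  rw [pbond, if_pos h0]

/-- Case of `par`. [folklore] -/
private theorem par_of_L (h0 : ¬ z 0 = l 0) (hL : z 0 ≤ a ∨ z 1 = l 1) : par l u a z = z - unitVec 0 := by
  rw [par, if_neg h0, if_pos hL]

/-- Case of `pbond`. [folklore] -/
private theorem pbond_of_L (h0 : ¬ z 0 = l 0) (hL : z 0 ≤ a ∨ z 1 = l 1) : pbond l u a z = (z - unitVec 0, 0) := by
  rw [pbond, if_neg h0, if_pos hL]

/-- Case of `par`. [folklore] -/
private theorem par_of_R_lt (h0 : ¬ z 0 = l 0) (hL : ¬ (z 0 ≤ a ∨ z 1 = l 1)) (hu : z 0 < u 0) :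
    par l u a z = z + unitVec 0 := by
  rw [par, if_neg h0, if_neg hL, if_pos hu]

/-- Case of `pbond`. [folklore] -/
private theorem pbond_of_R_lt (h0 : ¬ z 0 = l 0) (hL : ¬ (z 0 ≤ a ∨ z 1 = l 1)) (hu : z 0 < u 0) :
    pbond l u a z = (z, 0) := by
  rw [pbond, if_neg h0, if_neg hL, if_pos hu]

/-- Case of `par`. [folklore] -/
private theorem par_of_R_top (h0 : ¬ z 0 = l 0) (hL : ¬ (z 0 ≤ a ∨ z 1 = l 1)) (hu : ¬ z 0 < u 0) :
    par l u a z = z - unitVec 1 := by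
  rw [par, if_neg h0, if_neg hL, if_neg hu]

/-- Case of `pbond`. [folklore] -/
private theorem pbond_of_R_top (h0 : ¬ z 0 = l 0) (hL : ¬ (z 0 ≤ a ∨ z 1 = l 1)) (hu : ¬ z 0 < u 0) :
    pbond l u a z = (z - unitVec 1, 1) := by
  rw [pbond, if_neg h0, if_neg hL, if_neg hu]

end Cases

/-- `pbond z` joins `z` and `par z`. [cite: Balaban1989LargeFieldI, p.196] -/
theorem pbond_ends (l u : LPt n) (a : ℤ) (z : LPt n) :
    ((pbond l u a z).1 = par l u a z ∧ (pbond l u a z).hi = z) ∨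
      ((pbond l u a z).1 = z ∧ (pbond l u a z).hi = par l u a z) := by
  unfold pbond par LBond.hi
  split_ifs <;> simp

/-- The rank: the number of comb steps `Σ_i (z_i − y_i)`, plus `2(u₁ − z₁)` for the points reached through the far
face. [cite: Balaban1989LargeFieldI, p.196] -/
noncomputable def rexpr (l u : LPt n) (a : ℤ) (z : LPt n) : ℤ :=
  ∑ i, (z i - l i) + if z 0 ≤ a ∨ z 1 = l 1 then 0 else 2 * (u 0 - z 0)

/-- The rank as a natural number. [cite: Balaban1989LargeFieldI, p.196] -/
noncomputable def rank (l u : LPt n) (a : ℤ) (z : LPt n) : ℕ := (rexpr l u a z).toNat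

/-- The rank expression is nonnegative on the box. [folklore] -/
private theorem rexpr_nonneg {l u z : LPt n} (a : ℤ) (hz : z ∈ box l u) : 0 ≤ rexpr l u a z := by
  unfold rexpr
  have h1 := sum_sub_nonneg hz
  have h2 := (mem_box.1 hz 0).2
  split_ifs <;> omega

section Parent

variable {l u l' u' : LPt n} {a : ℤ} {z : LPt n}

/-- The parent of a point of `P₁∖P₂` other than `y` lies in `P₁∖P₂`. [cite: Balaban1989LargeFieldI, p.196] -/
theorem par_mem (h : Adm l u l' u' a) (hz : z ∈ ann l u l' u') (hzl : z ≠ l) :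
    par l u a z ∈ ann l u l' u' := by
  rw [mem_ann, mem_box, mem_box] at hz ⊢
  obtain ⟨hzb, hzP⟩ := hz
  have hl := h.l_le_a; have hlo := h.low₁; have hhi := h.high₁; have hl2 := h.low₂
  have ht1 := h.thr₁; have ht2 := h.thr₂
  have h01 : (0 : Fin (n + 2)) ≠ 1 := fin_zero_ne_one
  by_cases h0 : z 0 = l 0
  · -- on the face `z₁ = y₁`: the comb predecessor `z − e_m`
    obtain ⟨hm, -⟩ := mIdx_spec hzl
    have hm0 : mIdx l z ≠ 0 := fun e => hm (by rw [e]; exact h0)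
    rw [par_of_face h0]
    refine ⟨fun i => ?_, fun H => ?_⟩
    · by_cases him : i = mIdx l z
      · rw [him, sub_unitVec_self]; have := hzb (mIdx l z); omega
      · rw [sub_unitVec_ne _ him]; exact hzb i
    · have := (H 0).1; rw [sub_unitVec_ne _ (Ne.symm hm0)] at this; omega
  · by_cases hL : z 0 ≤ a ∨ z 1 = l 1
    · -- `z − e₁`
      rw [par_of_L h0 hL]
      have hz0 := hzb 0
      refine ⟨fun i => ?_, fun H => ?_⟩
      · by_cases hi0 : i = 0
        · rw [hi0, sub_unitVec_self]; omega
        · rw [sub_unitVec_ne _ hi0]; exact hzb i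
      · rcases hL with hza | hz1
        · apply hzP
          intro i
          by_cases hi0 : i = 0
          · rw [hi0]; have := H 0; rw [sub_unitVec_self] at this; omega
          · have := H i; rw [sub_unitVec_ne _ hi0] at this; exact this
        · have := (H 1).1; rw [sub_unitVec_ne _ h01.symm] at this; omega
    · have hL' : a < z 0 ∧ ¬ z 1 = l 1 := by rwa [not_or, not_le] at hL
      by_cases hu : z 0 < u 0
      · -- the return leg: `z + e₁`
        rw [par_of_R_lt h0 hL hu]
        refine ⟨fun i => ?_, fun H => ?_⟩
        · by_cases hi0 : i = 0
          · rw [hi0, add_unitVec_self]; have := hzb 0; omega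
          · rw [add_unitVec_ne _ hi0]; exact hzb i
        · apply hzP
          intro i
          by_cases hi0 : i = 0
          · rw [hi0]; have := H 0; rw [add_unitVec_self] at this; omega
          · have := H i; rw [add_unitVec_ne _ hi0] at this; exact this
      · -- the far face: `z − e₂`
        rw [par_of_R_top h0 hL hu]
        have hz1 := hzb 1
        refine ⟨fun i => ?_, fun H => ?_⟩
        · by_cases hi1 : i = 1
          · rw [hi1, sub_unitVec_self]; omega
          · rw [sub_unitVec_ne _ hi1]; exact hzb i
        · have := (H 0).2; rw [sub_unitVec_ne _ h01] at this; have := hzb 0; omega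

/-- The rank drops by exactly one from `z` to its parent. [cite: Balaban1989LargeFieldI, p.196] -/
theorem rexpr_par (h : Adm l u l' u' a) (hz : z ∈ ann l u l' u') (hzl : z ≠ l) :
    rexpr l u a (par l u a z) + 1 = rexpr l u a z := by
  rw [mem_ann, mem_box] at hz
  obtain ⟨hzb, -⟩ := hz
  have hl := h.l_le_a
  have h01 : (0 : Fin (n + 2)) ≠ 1 := fin_zero_ne_one
  by_cases h0 : z 0 = l 0
  · obtain ⟨hm, -⟩ := mIdx_spec hzl
    have hm0 : mIdx l z ≠ 0 := fun e => hm (by rw [e]; exact h0)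
    rw [par_of_face h0]
    unfold rexpr
    rw [sum_sub_sub_unitVec]
    have c1 : (z - unitVec (mIdx l z)) 0 ≤ a ∨ (z - unitVec (mIdx l z)) 1 = l 1 :=
      Or.inl (by rw [sub_unitVec_ne _ (Ne.symm hm0), h0]; exact hl)
    have c2 : z 0 ≤ a ∨ z 1 = l 1 := Or.inl (by rw [h0]; exact hl)
    rw [if_pos c1, if_pos c2]; ring
  · by_cases hL : z 0 ≤ a ∨ z 1 = l 1
    · rw [par_of_L h0 hL]
      unfold rexpr
      rw [sum_sub_sub_unitVec]
      have c1 : (z - unitVec (0 : Fin (n + 2))) 0 ≤ a ∨ (z - unitVec (0 : Fin (n + 2))) 1 = l 1 := by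
        rw [sub_unitVec_self, sub_unitVec_ne _ h01.symm]
        rcases hL with h' | h'
        · left; omega
        · right; exact h'
      rw [if_pos c1, if_pos hL]; ring
    · have hL' : a < z 0 ∧ ¬ z 1 = l 1 := by rwa [not_or, not_le] at hL
      by_cases hu : z 0 < u 0
      · rw [par_of_R_lt h0 hL hu]
        unfold rexpr
        rw [sum_sub_add_unitVec]
        have c1 : ¬ ((z + unitVec (0 : Fin (n + 2))) 0 ≤ a ∨ (z + unitVec (0 : Fin (n + 2))) 1 = l 1) := by
          rw [add_unitVec_self, add_unitVec_ne _ h01.symm, not_or]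
          exact ⟨by omega, hL'.2⟩
        rw [if_neg c1, if_neg hL, add_unitVec_self]; ring
      · rw [par_of_R_top h0 hL hu]
        unfold rexpr
        rw [sum_sub_sub_unitVec, if_neg hL, sub_unitVec_ne _ h01, sub_unitVec_self]
        have hz0 : z 0 = u 0 := by have := (hzb 0).2; omega
        by_cases c1 : z 0 ≤ a ∨ z 1 - 1 = l 1
        · rw [if_pos c1, hz0]; ring
        · rw [if_neg c1, hz0]; ring

/-- The rank strictly decreases along the parent map. [cite: Balaban1989LargeFieldI, p.196] -/
theorem rank_par_lt (h : Adm l u l' u' a) (hz : z ∈ ann l u l' u') (hzl : z ≠ l) :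
    rank l u a (par l u a z) < rank l u a z := by
  have h1 := rexpr_par h hz hzl
  have h2 := rexpr_nonneg a (mem_ann.1 (par_mem h hz hzl)).1
  unfold rank
  rw [Int.toNat_lt_toNat] <;> omega

/-- `T` rooted at `y`: the parent structure. [cite: Balaban1989LargeFieldI, p.196] -/
private theorem rooted (h : Adm l u l' u' a) : RootedOn (ann l u l' u') l (par l u a) (rank l u a) :=
  ⟨h.root_mem, fun _ hz hzl => par_mem h hz hzl, fun _ hz hzl => rank_par_lt h hz hzl⟩

end Parent


/-! ## §5  `T` is exactly the set of parent bonds -/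

section Bridge

variable {l u l' u' : LPt n} {a : ℤ}

/-- Case of `contour`. [folklore] -/
private theorem contour_of_le {x : LPt n} (hx : x 0 ≤ a) : contour l u a x = usual l x := by
  rw [contour, if_pos hx]

/-- Case of `contour`. [folklore] -/
private theorem contour_of_not_le {x : LPt n} (hx : ¬ x 0 ≤ a) : contour l u a x = detour l u x := by
  rw [contour, if_neg hx]

/-- The bond through which `Γ_{y,z}` enters `z` lies on `Γ_{y,z}`. [cite: Balaban1989LargeFieldI, p.196] -/
theorem pbond_mem_contour (h : Adm l u l' u' a) {z : LPt n} (hz : z ∈ ann l u l' u') (hzl : z ≠ l) :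
    pbond l u a z ∈ contour l u a z := by
  rw [mem_ann, mem_box] at hz
  obtain ⟨hzb, -⟩ := hz
  have hl := h.l_le_a
  have h01 : (0 : Fin (n + 2)) ≠ 1 := fin_zero_ne_one
  by_cases h0 : z 0 = l 0
  · -- comb bond on the face `z₁ = y₁`
    obtain ⟨hm, hmin⟩ := mIdx_spec hzl
    have hza : z 0 ≤ a := by rw [h0]; exact hl
    rw [contour_of_le hza, pbond_of_face h0, mem_usual]
    dsimp only
    refine ⟨mem_box.2 fun i => ?_, fun i hi => ?_, fun i hi => ?_, ?_⟩
    · by_cases him : i = mIdx l z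
      · rw [him, sub_unitVec_self]; have := hzb (mIdx l z); omega
      · rw [sub_unitVec_ne _ him]; exact ⟨(hzb i).1, le_rfl⟩
    · rw [sub_unitVec_ne _ (ne_of_lt hi)]; exact hmin i hi
    · rw [sub_unitVec_ne _ (ne_of_gt hi)]
    · rw [sub_unitVec_self]; omega
  · have hz0 : l 0 + 1 ≤ z 0 := by have := (hzb 0).1; omega
    by_cases hL : z 0 ≤ a ∨ z 1 = l 1
    · rw [pbond_of_L h0 hL]
      by_cases hza : z 0 ≤ a
      · -- last bond of the usual contour
        rw [contour_of_le hza, mem_usual]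
        dsimp only
        refine ⟨mem_box.2 fun i => ?_, fun i hi => absurd hi (not_lt_zero' i), fun i hi => ?_, ?_⟩
        · by_cases hi0 : i = 0
          · rw [hi0, sub_unitVec_self]; omega
          · rw [sub_unitVec_ne _ hi0]; exact ⟨(hzb i).1, le_rfl⟩
        · rw [sub_unitVec_ne _ (ne_of_gt hi)]
        · rw [sub_unitVec_self]; omega
      · -- a bond of the first detour leg (`z₂ = y₂`)
        have hz1 : z 1 = l 1 := hL.resolve_left hza
        rw [contour_of_not_le hza, mem_detour]
        dsimp only
        refine ⟨mem_box.2 fun i => ?_, Or.inr (Or.inl ⟨rfl, ?_, fun i hi => ?_, ?_⟩)⟩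
        · by_cases hi0 : i = 0
          · rw [hi0, sub_unitVec_self]; have := (hzb 0).2; omega
          · rw [sub_unitVec_ne _ hi0]; exact hzb i
        · rw [sub_unitVec_ne _ h01.symm, hz1]
        · rw [sub_unitVec_ne _ ((one_lt_iff i).1 hi).1]
        · rw [sub_unitVec_self]; have := (hzb 0).2; omega
    · have hL' : a < z 0 ∧ ¬ z 1 = l 1 := by rwa [not_or, not_le] at hL
      have hza : ¬ z 0 ≤ a := not_le.2 hL'.1
      rw [contour_of_not_le hza, mem_detour]
      by_cases hu : z 0 < u 0
      · -- a bond of the return leg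
        rw [pbond_of_R_lt h0 hL hu]
        dsimp only
        exact ⟨mem_box.2 hzb, Or.inr (Or.inr (Or.inr ⟨rfl, fun i _ => rfl, le_rfl, hu⟩))⟩
      · -- a bond of the leg on the far face
        rw [pbond_of_R_top h0 hL hu]
        dsimp only
        have hzu : z 0 = u 0 := by have := (hzb 0).2; omega
        have hz1 : l 1 + 1 ≤ z 1 := by have := (hzb 1).1; omega
        refine ⟨mem_box.2 fun i => ?_, Or.inr (Or.inr (Or.inl ⟨rfl, ?_, fun i hi => ?_, ?_⟩))⟩
        · by_cases hi1 : i = 1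
          · rw [hi1, sub_unitVec_self]; have := (hzb 1).2; omega
          · rw [sub_unitVec_ne _ hi1]; exact hzb i
        · rw [sub_unitVec_ne _ h01, hzu]
        · rw [sub_unitVec_ne _ ((one_lt_iff i).1 hi).2]
        · rw [sub_unitVec_self]; omega

/-- Every parent bond is a bond of `T`. [cite: Balaban1989LargeFieldI, p.196] -/
theorem pbond_mem_tree (h : Adm l u l' u' a) {z : LPt n} (hz : z ∈ ann l u l' u') (hzl : z ≠ l) :
    pbond l u a z ∈ tree l u l' u' a :=
  mem_tree.2 ⟨z, hz, pbond_mem_contour h hz hzl⟩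

/-- Every bond of a contour `Γ_{y,x}`, `x ∈ P₁∖P₂`, is the parent bond of a point of `P₁∖P₂` other than `y`
(leg-by-leg bookkeeping of p. 196; this is where the separation hypotheses enter). [cite: Balaban1989LargeFieldI, p.196] -/
theorem exists_pbond_eq (h : Adm l u l' u' a) {x : LPt n} (hx : x ∈ ann l u l' u') {b : LBond n}
    (hb : b ∈ contour l u a x) : ∃ z ∈ ann l u l' u', z ≠ l ∧ pbond l u a z = b := by
  obtain ⟨w, μ⟩ := b
  rw [mem_ann, mem_box, mem_box] at hx
  obtain ⟨hxb, hxP⟩ := hx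
  have hl := h.l_le_a; have hlo := h.low₁; have hhi := h.high₁; have hl2 := h.low₂
  have ht1 := h.thr₁; have ht2 := h.thr₂; have hlu := h.l_lt_u
  have h01 : (0 : Fin (n + 2)) ≠ 1 := fin_zero_ne_one
  by_cases hxa : x 0 ≤ a
  · rw [contour_of_le hxa, mem_usual] at hb
    obtain ⟨hwb, h1, h2, h3⟩ := hb
    rw [mem_box] at hwb
    simp only at h1 h2 h3 hwb
    by_cases hμ : μ = 0
    · subst hμ
      -- the last segment: `z = w + e₁`, of type `z₁ ≤ a`
      have hzi : ∀ i, i ≠ 0 → (w + unitVec (0 : Fin (n + 2))) i = x i :=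
        fun i hi => by rw [add_unitVec_ne _ hi]; exact h2 i ((zero_lt_iff i).2 hi)
      refine ⟨w + unitVec 0, mem_ann.2 ⟨mem_box.2 fun i => ?_, fun H => ?_⟩, fun e => ?_, ?_⟩
      · by_cases hi0 : i = 0
        · rw [hi0, add_unitVec_self]; have := hwb 0; have := hxb 0; omega
        · rw [hzi i hi0]; exact hxb i
      · rw [mem_box] at H
        apply hxP
        intro i
        by_cases hi0 : i = 0
        · rw [hi0]; have := H 0; rw [add_unitVec_self] at this; omega
        · rw [← hzi i hi0]; exact H i
      · have := congrFun e 0; rw [add_unitVec_self] at this; have := hwb 0; omega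
      · have hz0 : ¬ (w + unitVec (0 : Fin (n + 2))) 0 = l 0 := by
          rw [add_unitVec_self]; have := hwb 0; omega
        have hL : (w + unitVec (0 : Fin (n + 2))) 0 ≤ a ∨ (w + unitVec (0 : Fin (n + 2))) 1 = l 1 := by
          left; rw [add_unitVec_self]; have := hwb 0; omega
        rw [pbond_of_L hz0 hL, add_sub_cancel_right]
    · -- a comb segment on the face `w₁ = y₁`: `z = w + e_μ`
      have hw0 : w 0 = l 0 := h1 0 ((zero_lt_iff μ).2 hμ)
      refine ⟨w + unitVec μ, mem_ann.2 ⟨mem_box.2 fun i => ?_, fun H => ?_⟩, fun e => ?_, ?_⟩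
      · by_cases hiμ : i = μ
        · rw [hiμ, add_unitVec_self]; have := hwb μ; have := hxb μ; omega
        · rw [add_unitVec_ne _ hiμ]; have := hwb i; have := hxb i; omega
      · rw [mem_box] at H
        have := (H 0).1; rw [add_unitVec_ne _ (Ne.symm hμ), hw0] at this; omega
      · have := congrFun e μ; rw [add_unitVec_self] at this; have := hwb μ; omega
      · have hz0 : (w + unitVec μ) 0 = l 0 := by rw [add_unitVec_ne _ (Ne.symm hμ), hw0]
        have hm : mIdx l (w + unitVec μ) = μ := by
          refine mIdx_eq ?_ fun i hi => ?_
          · rw [add_unitVec_self]; have := hwb μ; omega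
          · rw [add_unitVec_ne _ (ne_of_lt hi)]; exact h1 i hi
        rw [pbond_of_face hz0, hm, add_sub_cancel_right]
  · have hxa' : a < x 0 := not_le.1 hxa
    rw [contour_of_not_le hxa, mem_detour] at hb
    obtain ⟨hwb, hlegs⟩ := hb
    rw [mem_box] at hwb
    simp only at hlegs hwb
    rcases hlegs with ⟨h2μ, h1, h2, h3⟩ | ⟨hμ, hw1, h2, h3⟩ | ⟨hμ, hw0, h2, h3⟩ | ⟨hμ, h2, h3, h4⟩
    · -- leg (a): a comb segment on the face `w₁ = y₁`
      have hμ : μ ≠ 0 := ((two_le_iff μ).1 h2μ).1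
      have hw0 : w 0 = l 0 := h1 0 ((zero_lt_iff μ).2 hμ)
      refine ⟨w + unitVec μ, mem_ann.2 ⟨mem_box.2 fun i => ?_, fun H => ?_⟩, fun e => ?_, ?_⟩
      · by_cases hiμ : i = μ
        · rw [hiμ, add_unitVec_self]; have := hwb μ; have := hxb μ; omega
        · rw [add_unitVec_ne _ hiμ]; exact hwb i
      · rw [mem_box] at H
        have := (H 0).1; rw [add_unitVec_ne _ (Ne.symm hμ), hw0] at this; omega
      · have := congrFun e μ; rw [add_unitVec_self] at this; have := hwb μ; omega
      · have hz0 : (w + unitVec μ) 0 = l 0 := by rw [add_unitVec_ne _ (Ne.symm hμ), hw0]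
        have hm : mIdx l (w + unitVec μ) = μ := by
          refine mIdx_eq ?_ fun i hi => ?_
          · rw [add_unitVec_self]; have := hwb μ; omega
          · rw [add_unitVec_ne _ (ne_of_lt hi)]; exact h1 i hi
        rw [pbond_of_face hz0, hm, add_sub_cancel_right]
    · -- leg (b): the first leg, on the line `w₂ = y₂`
      subst hμ
      refine ⟨w + unitVec 0, mem_ann.2 ⟨mem_box.2 fun i => ?_, fun H => ?_⟩, fun e => ?_, ?_⟩
      · by_cases hi0 : i = 0
        · rw [hi0, add_unitVec_self]; have := hwb 0; omega
        · rw [add_unitVec_ne _ hi0]; exact hwb i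
      · rw [mem_box] at H
        have := (H 1).1; rw [add_unitVec_ne _ h01.symm, hw1] at this; omega
      · have := congrFun e 0; rw [add_unitVec_self] at this; have := hwb 0; omega
      · have hz0 : ¬ (w + unitVec (0 : Fin (n + 2))) 0 = l 0 := by
          rw [add_unitVec_self]; have := hwb 0; omega
        have hL : (w + unitVec (0 : Fin (n + 2))) 0 ≤ a ∨ (w + unitVec (0 : Fin (n + 2))) 1 = l 1 := by
          right; rw [add_unitVec_ne _ h01.symm, hw1]
        rw [pbond_of_L hz0 hL, add_sub_cancel_right]
    · -- leg (c): on the far face `w₁ = u₁`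
      subst hμ
      refine ⟨w + unitVec 1, mem_ann.2 ⟨mem_box.2 fun i => ?_, fun H => ?_⟩, fun e => ?_, ?_⟩
      · by_cases hi1 : i = 1
        · rw [hi1, add_unitVec_self]; have := hwb 1; have := hxb 1; omega
        · rw [add_unitVec_ne _ hi1]; exact hwb i
      · rw [mem_box] at H
        have := (H 0).2; rw [add_unitVec_ne _ h01, hw0] at this; omega
      · have := congrFun e 0; rw [add_unitVec_ne _ h01, hw0] at this; omega
      · have hz0 : ¬ (w + unitVec (1 : Fin (n + 2))) 0 = l 0 := by
          rw [add_unitVec_ne _ h01, hw0]; omega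
        have hL : ¬ ((w + unitVec (1 : Fin (n + 2))) 0 ≤ a ∨ (w + unitVec (1 : Fin (n + 2))) 1 = l 1) := by
          rw [add_unitVec_ne _ h01, hw0, add_unitVec_self, not_or]
          have := hwb 1
          exact ⟨by omega, by omega⟩
        have hu : ¬ (w + unitVec (1 : Fin (n + 2))) 0 < u 0 := by
          rw [add_unitVec_ne _ h01, hw0]; omega
        rw [pbond_of_R_top hz0 hL hu, add_sub_cancel_right]
    · -- leg (d): the return leg
      subst hμ
      by_cases hx1 : x 1 = l 1
      · -- on the line `x₂ = y₂` the return bonds are first-leg bonds: `z = w + e₁`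
        refine ⟨w + unitVec 0, mem_ann.2 ⟨mem_box.2 fun i => ?_, fun H => ?_⟩, fun e => ?_, ?_⟩
        · by_cases hi0 : i = 0
          · rw [hi0, add_unitVec_self]; have := hwb 0; omega
          · rw [add_unitVec_ne _ hi0]; exact hwb i
        · rw [mem_box] at H
          have := (H 1).1
          rw [add_unitVec_ne _ h01.symm, h2 1 ((zero_lt_iff 1).2 h01.symm), hx1] at this; omega
        · have := congrFun e 0; rw [add_unitVec_self] at this; have := hwb 0; omega
        · have hz0 : ¬ (w + unitVec (0 : Fin (n + 2))) 0 = l 0 := by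
            rw [add_unitVec_self]; have := hwb 0; omega
          have hL : (w + unitVec (0 : Fin (n + 2))) 0 ≤ a ∨ (w + unitVec (0 : Fin (n + 2))) 1 = l 1 := by
            right; rw [add_unitVec_ne _ h01.symm, h2 1 ((zero_lt_iff 1).2 h01.symm), hx1]
          rw [pbond_of_L hz0 hL, add_sub_cancel_right]
      · -- generic return bond: `z = w` itself
        refine ⟨w, mem_ann.2 ⟨mem_box.2 hwb, fun H => ?_⟩, fun e => ?_, ?_⟩
        · rw [mem_box] at H
          apply hxP
          intro i
          by_cases hi0 : i = 0
          · rw [hi0]; have := H 0; omega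
          · rw [← h2 i ((zero_lt_iff i).2 hi0)]; exact H i
        · have := congrFun e 0; omega
        · have hz0 : ¬ w 0 = l 0 := by omega
          have hL : ¬ (w 0 ≤ a ∨ w 1 = l 1) := by
            rw [not_or, h2 1 ((zero_lt_iff 1).2 h01.symm)]; exact ⟨by omega, hx1⟩
          rw [pbond_of_R_lt hz0 hL h4]

/-- Every bond of `T` is a parent bond. [cite: Balaban1989LargeFieldI, p.196] -/
theorem exists_pbond_of_mem_tree (h : Adm l u l' u' a) {b : LBond n} (hb : b ∈ tree l u l' u' a) :
    ∃ z ∈ ann l u l' u', z ≠ l ∧ pbond l u a z = b := by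
  obtain ⟨x, hx, hbx⟩ := mem_tree.1 hb
  exact exists_pbond_eq h hx hbx

/-- `T` IS the set of parent bonds of the points of `P₁∖P₂` other than `y`. [cite: Balaban1989LargeFieldI, p.196] -/
theorem tree_eq_image (h : Adm l u l' u' a) :
    tree l u l' u' a = ((ann l u l' u').erase l).image (pbond l u a) := by
  ext b
  rw [Finset.mem_image]
  constructor
  · intro hb
    obtain ⟨z, hz, hzl, e⟩ := exists_pbond_of_mem_tree h hb
    exact ⟨z, Finset.mem_erase.2 ⟨hzl, hz⟩, e⟩
  · rintro ⟨z, hz, rfl⟩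
    obtain ⟨hzl, hz⟩ := Finset.mem_erase.1 hz
    exact pbond_mem_tree h hz hzl

/-- Distinct points have distinct parent bonds. [cite: Balaban1989LargeFieldI, p.196] -/
theorem pbond_injOn (h : Adm l u l' u' a) :
    Set.InjOn (pbond l u a) ↑((ann l u l' u').erase l) := by
  intro z hz z' hz' e
  obtain ⟨hzl, hz⟩ := Finset.mem_erase.1 (Finset.mem_coe.1 hz)
  obtain ⟨hz'l, hz'⟩ := Finset.mem_erase.1 (Finset.mem_coe.1 hz')
  refine (rooted h).eq_of_pair_eq hz hzl hz' hz'l ?_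
  have E1 := pbond_ends l u a z
  have E2 := pbond_ends l u a z'
  rw [e] at E1
  rcases E1 with ⟨a1, b1⟩ | ⟨a1, b1⟩ <;> rcases E2 with ⟨a2, b2⟩ | ⟨a2, b2⟩
  · exact Or.inl ⟨b1.symm.trans b2, a1.symm.trans a2⟩
  · exact Or.inr ⟨b1.symm.trans b2, a1.symm.trans a2⟩
  · exact Or.inr ⟨a1.symm.trans a2, b1.symm.trans b2⟩
  · exact Or.inl ⟨a1.symm.trans a2, b1.symm.trans b2⟩

/-- The graph of `T` on `P₁∖P₂` is the parent graph. [cite: Balaban1989LargeFieldI, p.196] -/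
private theorem bondGraph_tree_eq (h : Adm l u l' u' a) :
    bondGraph (tree l u l' u' a) (ann l u l' u') = parentGraph (ann l u l' u') l (par l u a) := by
  ext v w
  rw [bondGraph_adj, parentGraph_adj]
  refine and_congr_right fun _ => ⟨?_, ?_⟩
  · rintro (⟨b, hb, h1, h2⟩ | ⟨b, hb, h1, h2⟩)
    · obtain ⟨z, -, hzl, rfl⟩ := exists_pbond_of_mem_tree h hb
      rcases pbond_ends l u a z with ⟨e1, e2⟩ | ⟨e1, e2⟩
      · have hwz : (w : LPt n) = z := h2.symm.trans e2
        right; exact ⟨by rw [hwz]; exact hzl, by rw [hwz]; exact e1.symm.trans h1⟩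
      · have hvz : (v : LPt n) = z := h1.symm.trans e1
        left; exact ⟨by rw [hvz]; exact hzl, by rw [hvz]; exact e2.symm.trans h2⟩
    · obtain ⟨z, -, hzl, rfl⟩ := exists_pbond_of_mem_tree h hb
      rcases pbond_ends l u a z with ⟨e1, e2⟩ | ⟨e1, e2⟩
      · have hvz : (v : LPt n) = z := h2.symm.trans e2
        left; exact ⟨by rw [hvz]; exact hzl, by rw [hvz]; exact e1.symm.trans h1⟩
      · have hwz : (w : LPt n) = z := h1.symm.trans e1
        right; exact ⟨by rw [hwz]; exact hzl, by rw [hwz]; exact e2.symm.trans h2⟩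
  · rintro (⟨hv, hpv⟩ | ⟨hw, hpw⟩)
    · have hb := pbond_mem_tree h v.2 hv
      rcases pbond_ends l u a v with ⟨e1, e2⟩ | ⟨e1, e2⟩
      · right; exact ⟨_, hb, e1.trans hpv, e2⟩
      · left; exact ⟨_, hb, e1, e2.trans hpv⟩
    · have hb := pbond_mem_tree h w.2 hw
      rcases pbond_ends l u a w with ⟨e1, e2⟩ | ⟨e1, e2⟩
      · left; exact ⟨_, hb, e1.trans hpw, e2⟩
      · right; exact ⟨_, hb, e1, e2.trans hpw⟩

end Bridge

/-! ## §6  The printed claims of p. 196 -/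

section Main

variable {l u l' u' : LPt n} {a : ℤ}

/-- Each contour `Γ_{y,x}`, `x ∈ P₁∖P₂`, is part of `T`. [cite: Balaban1989LargeFieldI, p.196] -/
theorem contour_subset_tree {x : LPt n} (hx : x ∈ ann l u l' u') : contour l u a x ⊆ tree l u l' u' a :=
  Finset.subset_biUnion_of_mem (contour l u a) hx

/-- The contours run INSIDE `P₁∖P₂`: both end points of every bond of `T` are lattice points of `P₁∖P₂` (print:
*"a tree graph built of bonds contained in P₁∖P₂"*, p. 195). [cite: Balaban1989LargeFieldI, p.196] -/
theorem tree_ends_mem (h : Adm l u l' u' a) {b : LBond n} (hb : b ∈ tree l u l' u' a) :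
    b.1 ∈ ann l u l' u' ∧ b.hi ∈ ann l u l' u' := by
  obtain ⟨z, hz, hzl, rfl⟩ := exists_pbond_of_mem_tree h hb
  have hp := par_mem h hz hzl
  rcases pbond_ends l u a z with ⟨e1, e2⟩ | ⟨e1, e2⟩
  · rw [e1, e2]; exact ⟨hp, hz⟩
  · rw [e1, e2]; exact ⟨hz, hp⟩

/-- **p. 196, THE TREE PROPERTY**, verbatim: *"This slightly awkward definition describes a simplest family of contours
connecting points of P₁∖P₂ with the point y. The union of all the contours is a tree graph T on P₁∖P₂"* — PROVED:
the graph on the lattice points of `P₁∖P₂` whose edges are the bonds of `T = ⋃_{x∈P₁∖P₂} Γ_{y,x}` is a tree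
(connected and acyclic, Mathlib's `SimpleGraph.IsTree`), under the separation hypotheses `Adm`.
[cite: Balaban1989LargeFieldI, p.196] -/
theorem tree_isTree (h : Adm l u l' u' a) : (bondGraph (tree l u l' u' a) (ann l u l' u')).IsTree := by
  rw [bondGraph_tree_eq h]
  exact (rooted h).isTree

/-- **p. 196**, verbatim: *"We use all gauge degrees of freedom connected with points of P₁∖P₂, except one"* — the
count behind it: `T` has exactly `|P₁∖P₂| − 1` bonds. [cite: Balaban1989LargeFieldI, p.196] -/
theorem card_tree (h : Adm l u l' u' a) : (tree l u l' u' a).card + 1 = (ann l u l' u').card := by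
  rw [tree_eq_image h, Finset.card_image_of_injOn (pbond_injOn h), Finset.card_erase_of_mem h.root_mem]
  have := Finset.card_pos.2 ⟨l, h.root_mem⟩
  omega

/-- Enlarging `P₂` shrinks `P₁∖P₂`. [cite: Balaban1989LargeFieldI, p.196] -/
theorem ann_enlarge {l'' u'' : LPt n} (hsub : box l' u' ⊆ box l'' u'') :
    ann l u l'' u'' = ann l u l' u' \ (box l'' u'' \ box l' u') := by
  ext z
  simp only [mem_ann, Finset.mem_sdiff]
  constructor
  · rintro ⟨h1, h2⟩
    exact ⟨⟨h1, fun h3 => h2 (hsub h3)⟩, fun h3 => h2 h3.1⟩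
  · rintro ⟨⟨h1, h2⟩, h3⟩
    exact ⟨h1, fun h4 => h3 ⟨h4, h2⟩⟩

/-- **p. 196, THE NESTING PROPERTY**, verbatim: *"This definition has the important property that if we enlarge P₂,
i.e., we replace it by a rectangular parallelepiped P′₂, P₂ ⊂ P′₂ ⊂ P₁, and we remove the contours corresponding to
points of P′₂∖P₂, then the remaining contours build the corresponding graph T′ on P₁∖P′₂."* — with the same `y` and
`a` the contours do not depend on `P₂`, so removing from `T` the contours of the points of `P′₂∖P₂` leaves exactly
`T′`. [cite: Balaban1989LargeFieldI, p.196] -/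
theorem tree_enlarge {l'' u'' : LPt n} (hsub : box l' u' ⊆ box l'' u'') :
    tree l u l'' u'' a = (ann l u l' u' \ (box l'' u'' \ box l' u')).biUnion (contour l u a) := by
  rw [tree, ann_enlarge hsub]

/-- Hence `T′ ⊆ T`. [cite: Balaban1989LargeFieldI, p.196] -/
theorem tree_mono {l'' u'' : LPt n} (hsub : box l' u' ⊆ box l'' u'') :
    tree l u l'' u'' a ⊆ tree l u l' u' a := by
  rw [tree_enlarge hsub]
  exact Finset.biUnion_subset_biUnion_of_subset_left _ Finset.sdiff_subset

/-- The hypotheses pass to the enlarged `P′₂` once it, too, stays off the three faces of `P₁` (the threshold `a` needs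
no change: `a′₁(P′₂) ≤ a′₁ ≤ a + 1`, `a ≤ b′₁ ≤ b′₁(P′₂)`), so `T′` is again a tree (`tree_isTree`).
[cite: Balaban1989LargeFieldI, p.196] -/
theorem Adm.enlarge {l'' u'' : LPt n} (h : Adm l u l' u' a) (hl : l'' 0 ≤ l' 0) (hu : u' 0 ≤ u'' 0)
    (low₁ : l 0 < l'' 0) (high₁ : u'' 0 < u 0) (low₂ : l 1 < l'' 1) : Adm l u l'' u'' a :=
  ⟨h.le, low₁, high₁, low₂, le_trans hl h.thr₁, le_trans h.thr₂ hu⟩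

/-- DICTIONARY to *"the axial gauge in cubes used in the previous papers"* (p. 195): inside a cube `B(y)` of
[Balaban1984PropagatorsI] (1.6) the usual contour IS the contour (1.7) as typed in `B6BondElimination.contour`.
[cite: Balaban1989LargeFieldI, p.196] -/
theorem usual_eq_contour {L : ℕ} {y x : LPt n} (hx : x ∈ B6Elimination.block L y) :
    usual y x = B6BondElimination.contour L y x := by
  ext b
  rw [mem_usual, B6BondElimination.mem_contour, mem_box, B6Elimination.mem_block]
  have hxb := B6Elimination.mem_block.1 hx
  constructor
  · rintro ⟨hw, h1, h2, h3⟩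
    refine ⟨fun i => ⟨(hw i).1, ?_⟩, h1, h2, h3⟩
    have := (hw i).2; have := (hxb i).2; omega
  · rintro ⟨hw, h1, h2, h3⟩
    refine ⟨fun i => ⟨(hw i).1, ?_⟩, h1, h2, h3⟩
    rcases lt_trichotomy i b.2 with hi | hi | hi
    · rw [h1 i hi]; exact (hxb i).1
    · rw [hi]; exact le_of_lt h3
    · rw [h2 i hi]

end Main

/-! ## §7  Non-vacuity: the hypotheses are satisfiable (d = 2, `P₁ = [0,6]²`, `P₂ = [3,4]×[2,3]`, `a = 3`) -/

example : Adm (n := 0) ![0, 0] ![6, 6] ![3, 2] ![4, 3] 3 := by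
  refine ⟨fun i => ?_, ?_, ?_, ?_, ?_, ?_⟩
  · fin_cases i <;> simp
  all_goals simp


/-! ## §8 (v1.1)  Gluing trees, and the single-scale model of `T₀ = ⋃ (trees) ∪ (external bonds)` (p. 196)

p. 196, verbatim: *"We use all gauge degrees of freedom connected with points of P₁∖P₂, except one, so we add an
external bond to the graph. … We assume that P₂ is not the last domain in the sequence, i.e., P₂ ≠ (Ω″^{∼2}_{h+1})^c,
because no gauge is fixed in this domain, and no external bonds intersecting ∂P₂ are added to the graph. For the
remaining domains P₂ we choose the bond [(a′₁ − 1/2, a′₂ + 1/2, …, a′_d + 1/2), (a′₁ + 1/2, a′₂ + 1/2, …, a′_d + 1/2)],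
and add it to the graph. For P₁ = Λ we add also the additional bond [(y₁ − 1, y₂, …, y_d), y]. The union of the above
described tree graphs and bonds is denoted by T₀. It is a tree graph in 𝔹₀, fixing completely a gauge in this set."*

§8a is the folklore GLUING lemma behind the last sentence (a tree on `V′` attached by ONE bond from its root to ANY
vertex of a tree on a disjoint `V` gives a tree on `V ∪ V′`), in the rooted-parent-structure form of §1.  §8b is the
MODEL INSTANCE of `T₀` in which all the layers `P^0 = Λ ⊃ P^1 ⊃ ⋯ ⊃ P^m` (= `Λ ⊃ Z″_k ⊃ ⋯ ⊃ (Ω″^{∼2}_{h+1})^c`) are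
read on ONE unit lattice: `T₀ = ⋃_{i<m} T(P^i, P^{i+1}) ∪ {⟨l^i − e₁, l^i⟩ : i < m}` (the bond `i = 0` is the printed
`[(y₁ − 1, y₂, …, y_d), y]`, the bonds `1 ≤ i < m` are the printed external bonds of the non-last inner domains
`P₂ = P^i`), on the sites `𝔹₀ = (P^0 ∖ P^m) ∪ {y − e₁}`; PROVED: `T₀` is a tree on these sites (`T0_isTree`) with
exactly `|P^0 ∖ P^m|` bonds (`card_T0`, `card_T0_eq` — «fixing completely a gauge in this set»: one bond per site
whose gauge freedom is used).  HONEST SCOPE of §8b: in print consecutive layers live on lattices of DIFFERENT scales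
(«they are L-bonds for the unit scale in P₁») and the inner end of an external bond is then some vertex of the next
tree, not necessarily its root — §8a covers that (the connector is an arbitrary vertex); the single-scale `T0` below
attaches at the root.
-/

section Glue

variable {α : Type*} [DecidableEq α]

/-- The glued parent map: on `V′` the parent structure `p′`, except that the root `r′` is sent to the connector `c`;
elsewhere `p`. [folklore] -/
private def glueP (V' : Finset α) (r' c : α) (p p' : α → α) (z : α) : α :=
  if z ∈ V' then (if z = r' then c else p' z) else p z

/-- The glued rank: the ranks of `V′` shifted above all ranks of `V`. [folklore] -/
private def glueR (V V' : Finset α) (φ φ' : α → ℕ) (z : α) : ℕ :=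
  if z ∈ V' then V.sup φ + 1 + φ' z else φ z

/-- GLUING: a rooted parent structure on `V′`, attached by its root to any vertex `c` of a rooted parent structure on
a disjoint `V`, is a rooted parent structure on `V ∪ V′` (hence spans a tree, §1). [folklore] -/
private theorem RootedOn.glue {V V' : Finset α} {r r' c : α} {p p' : α → α} {φ φ' : α → ℕ}
    (h : RootedOn V r p φ) (h' : RootedOn V' r' p' φ') (hdisj : Disjoint V V') (hc : c ∈ V) :
    RootedOn (V ∪ V') r (glueP V' r' c p p') (glueR V V' φ φ') := by
  have hV : ∀ {z}, z ∈ V → z ∉ V' := fun hz hz' => Finset.disjoint_left.1 hdisj hz hz'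
  refine ⟨Finset.mem_union_left _ h.root_mem, fun z hz hzr => ?_, fun z hz hzr => ?_⟩
  · unfold glueP
    by_cases hz' : z ∈ V'
    · rw [if_pos hz']
      by_cases hzr' : z = r'
      · rw [if_pos hzr']; exact Finset.mem_union_left _ hc
      · rw [if_neg hzr']; exact Finset.mem_union_right _ (h'.parent_mem z hz' hzr')
    · rw [if_neg hz']
      have hzV : z ∈ V := (Finset.mem_union.1 hz).resolve_right hz'
      exact Finset.mem_union_left _ (h.parent_mem z hzV hzr)
  · unfold glueP glueR
    by_cases hz' : z ∈ V'
    · rw [if_pos hz', if_pos hz']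
      by_cases hzr' : z = r'
      · rw [if_pos hzr', if_neg (hV hc)]
        have := Finset.le_sup (f := φ) hc
        omega
      · rw [if_neg hzr', if_pos (h'.parent_mem z hz' hzr')]
        have := h'.rank_lt z hz' hzr'
        omega
    · have hzV : z ∈ V := (Finset.mem_union.1 hz).resolve_right hz'
      rw [if_neg hz', if_neg hz', if_neg (hV (h.parent_mem z hzV hzr))]
      exact h.rank_lt z hzV hzr

end Glue

section AbstractBridge

variable {V : Finset (LPt n)} {r : LPt n} {P : LPt n → LPt n} {pb : LPt n → LBond n} {T : Finset (LBond n)}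

/-- If `T` is exactly the set of the bonds `pb z`, `z ∈ V ∖ {r}`, each joining `z` to `P z`, then the graph of `T` on
`V` is the parent graph of `P`. [folklore] -/
private theorem bondGraph_eq_parentGraph
    (hjoin : ∀ z ∈ V, z ≠ r → ((pb z).1 = P z ∧ (pb z).hi = z) ∨ ((pb z).1 = z ∧ (pb z).hi = P z))
    (hT : ∀ b, b ∈ T ↔ ∃ z ∈ V, z ≠ r ∧ pb z = b) : bondGraph T V = parentGraph V r P := by
  ext v w
  rw [bondGraph_adj, parentGraph_adj]
  refine and_congr_right fun _ => ⟨?_, ?_⟩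
  · rintro (⟨b, hb, h1, h2⟩ | ⟨b, hb, h1, h2⟩)
    · obtain ⟨z, hz, hzl, rfl⟩ := (hT b).1 hb
      rcases hjoin z hz hzl with ⟨e1, e2⟩ | ⟨e1, e2⟩
      · have hwz : (w : LPt n) = z := h2.symm.trans e2
        right; exact ⟨by rw [hwz]; exact hzl, by rw [hwz]; exact e1.symm.trans h1⟩
      · have hvz : (v : LPt n) = z := h1.symm.trans e1
        left; exact ⟨by rw [hvz]; exact hzl, by rw [hvz]; exact e2.symm.trans h2⟩
    · obtain ⟨z, hz, hzl, rfl⟩ := (hT b).1 hb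
      rcases hjoin z hz hzl with ⟨e1, e2⟩ | ⟨e1, e2⟩
      · have hvz : (v : LPt n) = z := h2.symm.trans e2
        left; exact ⟨by rw [hvz]; exact hzl, by rw [hvz]; exact e1.symm.trans h1⟩
      · have hwz : (w : LPt n) = z := h1.symm.trans e1
        right; exact ⟨by rw [hwz]; exact hzl, by rw [hwz]; exact e2.symm.trans h2⟩
  · rintro (⟨hv, hpv⟩ | ⟨hw, hpw⟩)
    · have hb : pb v ∈ T := (hT _).2 ⟨v, v.2, hv, rfl⟩
      rcases hjoin v v.2 hv with ⟨e1, e2⟩ | ⟨e1, e2⟩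
      · right; exact ⟨_, hb, e1.trans hpv, e2⟩
      · left; exact ⟨_, hb, e1, e2.trans hpv⟩
    · have hb : pb w ∈ T := (hT _).2 ⟨w, w.2, hw, rfl⟩
      rcases hjoin w w.2 hw with ⟨e1, e2⟩ | ⟨e1, e2⟩
      · left; exact ⟨_, hb, e1.trans hpw, e2⟩
      · right; exact ⟨_, hb, e1, e2.trans hpw⟩

/-- … and then `|T| + 1 = |V|` (distinct vertices have distinct parent bonds). [folklore] -/
private theorem card_of_pbond {φ : LPt n → ℕ} (h : RootedOn V r P φ)
    (hjoin : ∀ z ∈ V, z ≠ r → ((pb z).1 = P z ∧ (pb z).hi = z) ∨ ((pb z).1 = z ∧ (pb z).hi = P z))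
    (hT : ∀ b, b ∈ T ↔ ∃ z ∈ V, z ≠ r ∧ pb z = b) : T.card + 1 = V.card := by
  have hTeq : T = (V.erase r).image pb := by
    ext b
    rw [hT b, Finset.mem_image]
    constructor
    · rintro ⟨z, hz, hzr, e⟩; exact ⟨z, Finset.mem_erase.2 ⟨hzr, hz⟩, e⟩
    · rintro ⟨z, hz, e⟩
      exact ⟨z, (Finset.mem_erase.1 hz).2, (Finset.mem_erase.1 hz).1, e⟩
  have hinj : Set.InjOn pb ↑(V.erase r) := by
    intro z hz z' hz' e
    obtain ⟨hzr, hz⟩ := Finset.mem_erase.1 (Finset.mem_coe.1 hz)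
    obtain ⟨hz'r, hz'⟩ := Finset.mem_erase.1 (Finset.mem_coe.1 hz')
    refine h.eq_of_pair_eq hz hzr hz' hz'r ?_
    have E1 := hjoin z hz hzr
    have E2 := hjoin z' hz' hz'r
    rw [e] at E1
    rcases E1 with ⟨a1, b1⟩ | ⟨a1, b1⟩ <;> rcases E2 with ⟨a2, b2⟩ | ⟨a2, b2⟩
    · exact Or.inl ⟨b1.symm.trans b2, a1.symm.trans a2⟩
    · exact Or.inr ⟨b1.symm.trans b2, a1.symm.trans a2⟩
    · exact Or.inr ⟨a1.symm.trans a2, b1.symm.trans b2⟩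
    · exact Or.inl ⟨a1.symm.trans a2, b1.symm.trans b2⟩
  rw [hTeq, Finset.card_image_of_injOn hinj, Finset.card_erase_of_mem h.root_mem]
  have := Finset.card_pos.2 ⟨r, h.root_mem⟩
  omega

end AbstractBridge

/-! ### §8b  The single-scale model of `T₀` -/

section T0

variable {L U : ℕ → LPt n} {A : ℕ → ℤ}

/-- The hypotheses on the chain `P^0 ⊃ P^1 ⊃ ⋯ ⊃ P^m` (`P^i = [L i, U i]`), thresholds `A i`: each consecutive pair is
admissible (`Adm`), and the boxes are nested with nonempty inner boxes (print: *"Λ ⊃ Z″_k ⊃ ⋯ ⊃ Z″_{h+1} ⊃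
(Ω″^{∼2}_{h+1})^c are rectangular parallelepipeds"*, separated by layers of `M`-cubes, p. 179).
[cite: Balaban1989LargeFieldI, p.196] -/
structure Chain (m : ℕ) (L U : ℕ → LPt n) (A : ℕ → ℤ) : Prop where
  adm : ∀ i, i < m → Adm (L i) (U i) (L (i + 1)) (U (i + 1)) (A i)
  nest : ∀ i, i < m → ∀ j, L i j ≤ L (i + 1) j ∧ L (i + 1) j ≤ U (i + 1) j ∧ U (i + 1) j ≤ U i j

/-- A chain restricts to its first `m` pairs. [cite: Balaban1989LargeFieldI, p.196] -/
theorem Chain.mono {m : ℕ} (h : Chain (m + 1) L U A) : Chain m L U A :=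
  ⟨fun i hi => h.adm i (Nat.lt_succ_of_lt hi), fun i hi => h.nest i (Nat.lt_succ_of_lt hi)⟩

/-- The `i`-th layer `P^i ∖ P^{i+1}`. [cite: Balaban1989LargeFieldI, p.196] -/
noncomputable def layer (L U : ℕ → LPt n) (i : ℕ) : Finset (LPt n) := ann (L i) (U i) (L (i + 1)) (U (i + 1))

/-- The EXTERNAL BOND into the root `l^i` of the `i`-th tree: `⟨l^i − e₁, l^i⟩` — for `i = 0` the printed
*"additional bond [(y₁ − 1, y₂, …, y_d), y]"* (`P₁ = Λ`), for `i ≥ 1` the printed bond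
*"[(a′₁ − 1/2, a′₂ + 1/2, …, a′_d + 1/2), (a′₁ + 1/2, a′₂ + 1/2, …, a′_d + 1/2)]"* of the inner domain `P₂ = P^i`.
[cite: Balaban1989LargeFieldI, p.196] -/
noncomputable def extBond (L : ℕ → LPt n) (i : ℕ) : LBond n := (L i - unitVec 0, 0)

/-- The outer end `y − e₁` of the additional bond at `Λ` (a site outside `Λ`). [cite: Balaban1989LargeFieldI, p.196] -/
noncomputable def outRoot (L : ℕ → LPt n) : LPt n := L 0 - unitVec 0

/-- The sites carrying `T₀`: `(P^0 ∖ P^m) ∪ {y − e₁}` — the union of the layers and the outer end of the `Λ`-bond.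
[cite: Balaban1989LargeFieldI, p.196] -/
noncomputable def sites (L U : ℕ → LPt n) (m : ℕ) : Finset (LPt n) :=
  {outRoot L} ∪ (Finset.range m).biUnion (layer L U)

/-- **`T₀`** (single-scale model), verbatim *"The union of the above described tree graphs and bonds is denoted by
T₀"*: the trees of the consecutive pairs and the external bonds. [cite: Balaban1989LargeFieldI, p.196] -/
noncomputable def T0 (L U : ℕ → LPt n) (A : ℕ → ℤ) (m : ℕ) : Finset (LBond n) :=
  (Finset.range m).biUnion (fun i => tree (L i) (U i) (L (i + 1)) (U (i + 1)) (A i)) ∪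
    (Finset.range m).image (extBond L)

/-- One more layer: the sites. [cite: Balaban1989LargeFieldI, p.196] -/
theorem sites_succ (L U : ℕ → LPt n) (m : ℕ) : sites L U (m + 1) = sites L U m ∪ layer L U m := by
  rw [sites, sites, Finset.range_add_one, Finset.biUnion_insert, Finset.union_comm (layer L U m),
    Finset.union_assoc]

/-- One more layer: the bonds. [cite: Balaban1989LargeFieldI, p.196] -/
theorem T0_succ (L U : ℕ → LPt n) (A : ℕ → ℤ) (m : ℕ) :
    T0 L U A (m + 1) = T0 L U A m ∪ tree (L m) (U m) (L (m + 1)) (U (m + 1)) (A m) ∪ {extBond L m} := by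
  ext b
  simp only [T0, Finset.range_add_one, Finset.biUnion_insert, Finset.image_insert, Finset.mem_union,
    Finset.mem_insert, Finset.mem_singleton]
  tauto

/-- No bonds and one site for the empty chain. [cite: Balaban1989LargeFieldI, p.196] -/
theorem T0_zero (L U : ℕ → LPt n) (A : ℕ → ℤ) : T0 L U A 0 = ∅ := by
  simp [T0]

/-- One site (the outer root) and no layer for the empty chain. [cite: Balaban1989LargeFieldI, p.196] -/
theorem sites_zero (L U : ℕ → LPt n) : sites L U 0 = {outRoot L} := by
  simp [sites]

/-- Nested boxes: `P^j ⊆ P^i` for `i ≤ j ≤ m`. [cite: Balaban1989LargeFieldI, p.196] -/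
theorem Chain.box_subset {m : ℕ} (h : Chain m L U A) {i j : ℕ} (hij : i ≤ j) (hj : j ≤ m) :
    box (L j) (U j) ⊆ box (L i) (U i) := by
  induction j with
  | zero =>
    have : i = 0 := by omega
    subst this; exact le_rfl
  | succ j ih =>
    rcases Nat.eq_or_lt_of_le hij with e | hlt
    · rw [e]
    · refine le_trans ?_ (ih (by omega) (by omega))
      intro z hz
      rw [mem_box] at hz ⊢
      intro q
      have := h.nest j (by omega) q
      have := hz q
      exact ⟨by omega, by omega⟩

/-- The new layer is disjoint from the sites already present. [cite: Balaban1989LargeFieldI, p.196] -/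
theorem Chain.disjoint_sites_layer {m : ℕ} (h : Chain (m + 1) L U A) : Disjoint (sites L U m) (layer L U m) := by
  rw [Finset.disjoint_left]
  intro z hz hz'
  have hzm : z ∈ box (L m) (U m) := (mem_ann.1 hz').1
  rw [sites, Finset.mem_union, Finset.mem_singleton, Finset.mem_biUnion] at hz
  rcases hz with rfl | ⟨i, hi, hzi⟩
  · -- the outer root lies below `Λ` in the first coordinate
    have h0 := h.box_subset (Nat.zero_le m) (Nat.le_succ m) hzm
    rw [mem_box] at h0
    have := (h0 0).1
    rw [outRoot, sub_unitVec_self] at this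
    omega
  · rw [Finset.mem_range] at hi
    have hsub := h.box_subset (i := i + 1) (j := m) (by omega) (Nat.le_succ m) hzm
    exact (mem_ann.1 hzi).2 hsub

/-- The inner end of the external bond: the root `l^m` of the new tree lies in the new layer.
[cite: Balaban1989LargeFieldI, p.196] -/
theorem Chain.root_mem_layer {m : ℕ} (h : Chain (m + 1) L U A) : L m ∈ layer L U m :=
  (h.adm m (Nat.lt_succ_self m)).root_mem

/-- The outer end `l^m − e₁` of the `m`-th external bond is a site already present: the outer root for `m = 0`, a
point of the previous layer for `m ≥ 1`. [cite: Balaban1989LargeFieldI, p.196] -/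
theorem Chain.conn_mem_sites {m : ℕ} (h : Chain (m + 1) L U A) : L m - unitVec 0 ∈ sites L U m := by
  rw [sites, Finset.mem_union, Finset.mem_singleton]
  rcases Nat.eq_zero_or_pos m with rfl | hm
  · left; rfl
  · right
    rw [Finset.mem_biUnion]
    refine ⟨m - 1, Finset.mem_range.2 (by omega), ?_⟩
    obtain ⟨k, rfl⟩ : ∃ k, m = k + 1 := ⟨m - 1, by omega⟩
    rw [Nat.add_sub_cancel, layer, mem_ann, mem_box, mem_box]
    have ha := h.adm k (by omega)
    have hn := h.nest k (by omega)
    refine ⟨fun q => ?_, fun H => ?_⟩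
    · by_cases hq : q = 0
      · rw [hq, sub_unitVec_self]
        have := ha.low₁; have := ha.thr₁; have := ha.thr₂; have := ha.high₁
        exact ⟨by omega, by omega⟩
      · rw [sub_unitVec_ne _ hq]
        have := hn q
        exact ⟨this.1, le_trans this.2.1 this.2.2⟩
    · have := (H 0).1
      rw [sub_unitVec_self] at this
      omega

/-- The glued parent map of `T₀` (recursively over the layers). [cite: Balaban1989LargeFieldI, p.196] -/
private noncomputable def P0 (L U : ℕ → LPt n) (A : ℕ → ℤ) : ℕ → LPt n → LPt n
  | 0 => fun z => z
  | m + 1 => glueP (layer L U m) (L m) (L m - unitVec 0) (P0 L U A m) (par (L m) (U m) (A m))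

/-- The glued rank of `T₀`. [cite: Balaban1989LargeFieldI, p.196] -/
private noncomputable def R0 (L U : ℕ → LPt n) (A : ℕ → ℤ) : ℕ → LPt n → ℕ
  | 0 => fun _ => 0
  | m + 1 => glueR (sites L U m) (layer L U m) (R0 L U A m) (rank (L m) (U m) (A m))

/-- The bond of `T₀` entering a site: the external bond at a root, the tree's parent bond elsewhere.
[cite: Balaban1989LargeFieldI, p.196] -/
private noncomputable def pb0 (L U : ℕ → LPt n) (A : ℕ → ℤ) : ℕ → LPt n → LBond n
  | 0 => fun z => (z, 0)
  | m + 1 => fun z => if z ∈ layer L U m then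
      (if z = L m then extBond L m else pbond (L m) (U m) (A m) z) else pb0 L U A m z

/-- `T₀` rooted at the outer end of the `Λ`-bond: the glued parent structure. [cite: Balaban1989LargeFieldI, p.196] -/
private theorem rooted0 : ∀ {m : ℕ}, Chain m L U A → RootedOn (sites L U m) (outRoot L) (P0 L U A m) (R0 L U A m)
  | 0, _ => ⟨by simp [sites_zero], fun z hz hzr => by simp [sites_zero] at hz; exact absurd hz hzr,
      fun z hz hzr => by simp [sites_zero] at hz; exact absurd hz hzr⟩
  | m + 1, h => by
    rw [sites_succ]
    exact (rooted0 h.mono).glue (rooted (h.adm m (Nat.lt_succ_self m))) h.disjoint_sites_layer h.conn_mem_sites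

/-- Every bond `pb0 z` joins `z` to its glued parent. [cite: Balaban1989LargeFieldI, p.196] -/
private theorem pb0_joins : ∀ {m : ℕ}, Chain m L U A → ∀ z ∈ sites L U m, z ≠ outRoot L →
    ((pb0 L U A m z).1 = P0 L U A m z ∧ (pb0 L U A m z).hi = z) ∨
      ((pb0 L U A m z).1 = z ∧ (pb0 L U A m z).hi = P0 L U A m z)
  | 0, _, z, hz, hzr => by simp [sites_zero] at hz; exact absurd hz hzr
  | m + 1, h, z, hz, hzr => by
    simp only [pb0, P0, glueP]
    by_cases hzl : z ∈ layer L U m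
    · rw [if_pos hzl, if_pos hzl]
      by_cases hzL : z = L m
      · rw [if_pos hzL, if_pos hzL]
        left
        refine ⟨rfl, ?_⟩
        rw [LBond.hi, extBond, hzL]
        simp
      · rw [if_neg hzL, if_neg hzL]
        exact pbond_ends (L m) (U m) (A m) z
    · rw [if_neg hzl, if_neg hzl]
      have hz' : z ∈ sites L U m := by
        rw [sites_succ, Finset.mem_union] at hz
        exact hz.resolve_right hzl
      exact pb0_joins h.mono z hz' hzr

/-- `T₀` IS the set of the bonds `pb0 z` over its sites other than the outer root. [cite: Balaban1989LargeFieldI, p.196] -/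
private theorem mem_T0_iff : ∀ {m : ℕ}, Chain m L U A → ∀ b,
    b ∈ T0 L U A m ↔ ∃ z ∈ sites L U m, z ≠ outRoot L ∧ pb0 L U A m z = b
  | 0, _, b => by
    simp only [T0_zero, Finset.notMem_empty, sites_zero, Finset.mem_singleton, false_iff, not_exists,
      not_and]
    intro z hz hzr; exact absurd hz hzr
  | m + 1, h, b => by
    have ih := mem_T0_iff h.mono
    have hadm := h.adm m (Nat.lt_succ_self m)
    have hdisj := h.disjoint_sites_layer
    have hnot : ∀ {z}, z ∈ sites L U m → z ∉ layer L U m :=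
      fun hz hz' => Finset.disjoint_left.1 hdisj hz hz'
    have hLne : L m ≠ outRoot L := fun e =>
      hnot (by rw [sites]; exact Finset.mem_union_left _ (Finset.mem_singleton_self _))
        (e ▸ h.root_mem_layer)
    rw [T0_succ, Finset.mem_union, Finset.mem_union, Finset.mem_singleton, ih,
      tree_eq_image hadm, Finset.mem_image]
    constructor
    · rintro ((⟨z, hz, hzr, e⟩ | ⟨z, hz, e⟩) | rfl)
      · refine ⟨z, by rw [sites_succ]; exact Finset.mem_union_left _ hz, hzr, ?_⟩
        simp only [pb0]; rw [if_neg (hnot hz)]; exact e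
      · obtain ⟨hzL, hzl⟩ := Finset.mem_erase.1 hz
        have hzl' : z ∈ layer L U m := hzl
        refine ⟨z, by rw [sites_succ]; exact Finset.mem_union_right _ hzl', fun e' => ?_, ?_⟩
        · exact hnot (by rw [e', sites]; exact Finset.mem_union_left _ (Finset.mem_singleton_self _)) hzl'
        · simp only [pb0]; rw [if_pos hzl', if_neg hzL]; exact e
      · refine ⟨L m, by rw [sites_succ]; exact Finset.mem_union_right _ h.root_mem_layer, hLne, ?_⟩
        have hr := h.root_mem_layer
        simp [pb0, hr]
    · rintro ⟨z, hz, hzr, e⟩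
      simp only [pb0] at e
      by_cases hzl : z ∈ layer L U m
      · rw [if_pos hzl] at e
        by_cases hzL : z = L m
        · rw [if_pos hzL] at e; right; exact e.symm
        · rw [if_neg hzL] at e; left; right; exact ⟨z, Finset.mem_erase.2 ⟨hzL, hzl⟩, e⟩
      · rw [if_neg hzl] at e
        have hz' : z ∈ sites L U m := by
          rw [sites_succ, Finset.mem_union] at hz; exact hz.resolve_right hzl
        left; left; exact ⟨z, hz', hzr, e⟩

/-- **p. 196, `T₀` IS A TREE** (single-scale model), verbatim *"The union of the above described tree graphs and bonds
is denoted by T₀. It is a tree graph in 𝔹₀"*: the graph of `T₀ = ⋃_{i<m} T(P^i, P^{i+1}) ∪ {⟨l^i − e₁, l^i⟩ : i < m}`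
on the sites `(P^0 ∖ P^m) ∪ {y − e₁}` is a tree. [cite: Balaban1989LargeFieldI, p.196] -/
theorem T0_isTree {m : ℕ} (h : Chain m L U A) : (bondGraph (T0 L U A m) (sites L U m)).IsTree := by
  rw [bondGraph_eq_parentGraph (pb0_joins h) (mem_T0_iff h)]
  exact (rooted0 h).isTree

/-- `|T₀| + 1 = |sites|`. [cite: Balaban1989LargeFieldI, p.196] -/
theorem card_T0 {m : ℕ} (h : Chain m L U A) : (T0 L U A m).card + 1 = (sites L U m).card :=
  card_of_pbond (rooted0 h) (pb0_joins h) (mem_T0_iff h)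

/-- **p. 196**, verbatim *"fixing completely a gauge in this set"* — the count behind it: `T₀` has exactly as many
bonds as there are sites in the layers `P^0 ∖ P^m` (one per gauge degree of freedom used; the outer end `y − e₁`
carries none). [cite: Balaban1989LargeFieldI, p.196] -/
theorem card_T0_eq {m : ℕ} (h : Chain m L U A) :
    (T0 L U A m).card = ((Finset.range m).biUnion (layer L U)).card := by
  have hc := card_T0 h
  have hr : outRoot L ∉ (Finset.range m).biUnion (layer L U) := by
    intro hmem
    rw [Finset.mem_biUnion] at hmem
    obtain ⟨i, hi, hz⟩ := hmem
    rw [Finset.mem_range] at hi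
    have hzm : outRoot L ∈ box (L i) (U i) := (mem_ann.1 hz).1
    have h0 := h.box_subset (Nat.zero_le i) (le_of_lt hi) hzm
    rw [mem_box] at h0
    have := (h0 0).1
    rw [outRoot, sub_unitVec_self] at this
    omega
  rw [sites, Finset.card_union_of_disjoint (Finset.disjoint_singleton_left.2 hr), Finset.card_singleton] at hc
  omega

end T0

/-! Non-vacuity of `Chain`: one admissible pair `P^0 = [0,6]² ⊃ P^1 = [3,4]×[2,3]`, `a = 3` (d = 2). -/

example : Chain (n := 0) 1 (fun i => if i = 0 then ![0, 0] else ![3, 2])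
    (fun i => if i = 0 then ![6, 6] else ![4, 3]) (fun _ => 3) := by
  refine ⟨fun i hi => ?_, fun i hi j => ?_⟩
  · obtain rfl : i = 0 := by omega
    refine ⟨fun j => ?_, ?_, ?_, ?_, ?_, ?_⟩
    · fin_cases j <;> simp
    all_goals simp
  · obtain rfl : i = 0 := by omega
    fin_cases j <;> simp


/-! ## §9 (v1.2)  Re-rooting a parent structure, and the MULTI-SCALE model of `T₀` (p. 196)

p. 196, verbatim: *"We use all gauge degrees of freedom connected with points of P₁∖P₂, except one, so we add an external
bond to the graph. It is one of the bonds intersecting the boundary ∂P₁, but they are bonds of the larger scale (they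
are L-bonds for the unit scale in P₁), except when P₁ = Λ, so it is simpler to describe the corresponding bond for P₂.
… For the remaining domains P₂ we choose the bond [(a′₁ − 1/2, a′₂ + 1/2, …, a′_d + 1/2), (a′₁ + 1/2, a′₂ + 1/2, …,
a′_d + 1/2)], and add it to the graph. For P₁ = Λ we add also the additional bond [(y₁ − 1, y₂, …, y_d), y]. The union
of the above described tree graphs and bonds is denoted by T₀. It is a tree graph in 𝔹₀, fixing completely a gauge in
this set."*

In print consecutive layers `P^i ∖ P^{i+1}` live on lattices of DIFFERENT scales («L-bonds for the unit scale in P₁»),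
each layer being read on its own unit lattice («We may assume, rescaling properly, that it is the unit lattice»,
p. 195); the external bond of `P₂ = P^i` joins a point of the layer `P^{i−1} ∖ P^i` (its outer end
`(a′₁ − 1/2, a′₂ + 1/2, …)`) to the point of the finer layer `P^i ∖ P^{i+1}` lying under `(a′₁ + 1/2, …, a′_d + 1/2)` —
in general NOT the initial point of that layer's tree.  §9a is the folklore RE-ROOTING lemma this needs (a rooted
parent structure re-rooted at any of its vertices is a rooted parent structure with the same edges); §9b the
multi-scale model: layers = admissible annuli each in its own coordinates (vertices tagged by the layer index), the
trees of §3 in each layer, and external bonds between PARAMETER points `u_i ∈ layer i−1`, `c_i ∈ layer i` (print's two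
ends; their position plays no role in the tree property), plus the `Λ`-bond `[(y₁ − 1, y₂, …, y_d), y]`; PROVED: the
union is a tree on the tagged sites with one bond per site of the layers (`MT0_isTree`, `card_MT0`). -/

section Reroot

variable {α : Type*} [DecidableEq α] {V : Finset α} {r : α} {p : α → α} {φ : α → ℕ}

namespace RootedOn

omit [DecidableEq α] in
/-- Iterating the parent map from a vertex: while the root is not met, the iterates stay in `V` and the rank drops by at
least one per step. [folklore] -/
private theorem iter_mem_rank (h : RootedOn V r p φ) {c : α} (hc : c ∈ V) :
    ∀ j : ℕ, (∀ i, i < j → p^[i] c ≠ r) → p^[j] c ∈ V ∧ φ (p^[j] c) + j ≤ φ c := by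
  intro j
  induction j with
  | zero => intro _; exact ⟨by simpa using hc, by simp⟩
  | succ j ih =>
    intro hj
    obtain ⟨hmem, hrk⟩ := ih fun i hi => hj i (Nat.lt_succ_of_lt hi)
    have hne : p^[j] c ≠ r := hj j (Nat.lt_succ_self j)
    rw [Function.iterate_succ_apply']
    exact ⟨h.parent_mem _ hmem hne, by have := h.rank_lt _ hmem hne; omega⟩

omit [DecidableEq α] in
/-- Iterating the parent map from any vertex reaches the root. [folklore] -/
private theorem exists_iter_eq_root (h : RootedOn V r p φ) {c : α} (hc : c ∈ V) : ∃ j : ℕ, p^[j] c = r := by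
  by_contra hne
  have := (h.iter_mem_rank hc (φ c + 1) fun i _ e => hne ⟨i, e⟩).2
  omega

end RootedOn

open scoped Classical in
/-- THE LENGTH OF THE PATH from `c` to the root `r` along the parent map `p` (the least `j` with `p^[j] c = r`; junk `0`
if there is none). [folklore] -/
private noncomputable def pathLen (p : α → α) (c r : α) : ℕ :=
  if h : ∃ j : ℕ, p^[j] c = r then Nat.find h else 0

/-- `z` lies ON THE PATH `c, p c, …, p^[J] c`. [folklore] -/
private def OnPath (p : α → α) (c : α) (J : ℕ) (z : α) : Prop := ∃ j, j ≤ J ∧ p^[j] c = z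

open scoped Classical in
/-- THE RE-ROOTED PARENT MAP: on the path the parent is the PREVIOUS path point (the path is reversed), elsewhere the old
parent. [folklore] -/
private noncomputable def rerootP (p : α → α) (c : α) (J : ℕ) (z : α) : α :=
  if h : OnPath p c J z then p^[Nat.find h - 1] c else p z

open scoped Classical in
/-- THE RE-ROOTED RANK: the path index on the path, the old rank shifted above all path indices elsewhere. [folklore] -/
private noncomputable def rerootR (p : α → α) (φ : α → ℕ) (c : α) (J : ℕ) (z : α) : ℕ :=
  if h : OnPath p c J z then Nat.find h else φ z + J + 1

open scoped Classical in
/-- THE OLD VERTEX OWNING THE NEW PARENT EDGE of `z`: the previous path point on the path, `z` itself elsewhere (the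
re-rooted parent edge of `z` is the old parent edge of `pathPrev z`). [folklore] -/
private noncomputable def pathPrev (p : α → α) (c : α) (J : ℕ) (z : α) : α :=
  if h : OnPath p c J z then p^[Nat.find h - 1] c else z

namespace RootedOn

variable {c : α}

/-- The path length is attained: `p^[pathLen] c = r`. [folklore] -/
private theorem iter_pathLen (h : RootedOn V r p φ) (hc : c ∈ V) : p^[pathLen p c r] c = r := by
  have hex := h.exists_iter_eq_root hc
  rw [pathLen, dif_pos hex]
  exact Nat.find_spec hex

/-- Before the path length the root is not met. [folklore] -/
private theorem iter_ne_root (h : RootedOn V r p φ) (hc : c ∈ V) {i : ℕ} (hi : i < pathLen p c r) : p^[i] c ≠ r := by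
  have hex := h.exists_iter_eq_root hc
  rw [pathLen, dif_pos hex] at hi
  exact Nat.find_min hex hi

/-- Path points lie in `V`. [folklore] -/
private theorem iter_mem (h : RootedOn V r p φ) (hc : c ∈ V) {j : ℕ} (hj : j ≤ pathLen p c r) : p^[j] c ∈ V :=
  (h.iter_mem_rank hc j fun _ hi => h.iter_ne_root hc (lt_of_lt_of_le hi hj)).1

/-- The rank strictly decreases along the path. [folklore] -/
private theorem rank_iter_lt (h : RootedOn V r p φ) (hc : c ∈ V) {i j : ℕ} (hij : i < j) (hj : j ≤ pathLen p c r) :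
    φ (p^[j] c) < φ (p^[i] c) := by
  -- apply `iter_mem_rank` from the vertex `p^[i] c`
  have hci : p^[i] c ∈ V := h.iter_mem hc (le_of_lt (lt_of_lt_of_le hij hj))
  obtain ⟨d, rfl⟩ : ∃ d, j = i + (d + 1) := ⟨j - i - 1, by omega⟩
  have key := h.iter_mem_rank hci (d + 1) fun t ht heq => by
    have : p^[t + i] c = r := by rw [Function.iterate_add_apply]; exact heq
    exact h.iter_ne_root hc (by omega) this
  have e : p^[d + 1] (p^[i] c) = p^[i + (d + 1)] c := by
    rw [← Function.iterate_add_apply, Nat.add_comm]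
  rw [← e]
  have := key.2
  omega

/-- Path points are pairwise distinct (indices `≤ pathLen`). [folklore] -/
private theorem iter_inj (h : RootedOn V r p φ) (hc : c ∈ V) {i j : ℕ} (hi : i ≤ pathLen p c r) (hj : j ≤ pathLen p c r)
    (e : p^[i] c = p^[j] c) : i = j := by
  by_contra hne
  rcases lt_or_gt_of_ne hne with hlt | hlt
  · have := h.rank_iter_lt hc hlt hj; rw [e] at this; exact lt_irrefl _ this
  · have := h.rank_iter_lt hc hlt hi; rw [e] at this; exact lt_irrefl _ this

/-- The path index of a path point. [folklore] -/
private theorem find_onPath (h : RootedOn V r p φ) (hc : c ∈ V) {j : ℕ} (hj : j ≤ pathLen p c r)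
    (hex : OnPath p c (pathLen p c r) (p^[j] c)) : Nat.find hex = j := by
  obtain ⟨hle, heq⟩ := Nat.find_spec hex
  exact h.iter_inj hc hle hj heq

/-- The re-rooted parent of a path point is the previous path point. [folklore] -/
private theorem rerootP_iter (h : RootedOn V r p φ) (hc : c ∈ V) {j : ℕ} (hj : j ≤ pathLen p c r) :
    rerootP p c (pathLen p c r) (p^[j] c) = p^[j - 1] c := by
  have hex : OnPath p c (pathLen p c r) (p^[j] c) := ⟨j, hj, rfl⟩
  rw [rerootP, dif_pos hex, h.find_onPath hc hj hex]

/-- The re-rooted rank of a path point is its index. [folklore] -/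
private theorem rerootR_iter (h : RootedOn V r p φ) (hc : c ∈ V) {j : ℕ} (hj : j ≤ pathLen p c r) :
    rerootR p φ c (pathLen p c r) (p^[j] c) = j := by
  have hex : OnPath p c (pathLen p c r) (p^[j] c) := ⟨j, hj, rfl⟩
  rw [rerootR, dif_pos hex, h.find_onPath hc hj hex]

/-- Off the path the re-rooted parent is the old parent. [folklore] -/
private theorem rerootP_of_not {J : ℕ} {z : α} (hz : ¬ OnPath p c J z) : rerootP p c J z = p z := by
  rw [rerootP, dif_neg hz]

/-- Off the path the re-rooted rank is the shifted old rank. [folklore] -/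
private theorem rerootR_of_not {J : ℕ} {z : α} (hz : ¬ OnPath p c J z) : rerootR p φ c J z = φ z + J + 1 := by
  rw [rerootR, dif_neg hz]

/-- On the path `pathPrev` is the previous path point. [folklore] -/
private theorem pathPrev_iter (h : RootedOn V r p φ) (hc : c ∈ V) {j : ℕ} (hj : j ≤ pathLen p c r) :
    pathPrev p c (pathLen p c r) (p^[j] c) = p^[j - 1] c := by
  have hex : OnPath p c (pathLen p c r) (p^[j] c) := ⟨j, hj, rfl⟩
  rw [pathPrev, dif_pos hex, h.find_onPath hc hj hex]

/-- Off the path `pathPrev z = z`. [folklore] -/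
private theorem pathPrev_of_not {J : ℕ} {z : α} (hz : ¬ OnPath p c J z) : pathPrev p c J z = z := by
  rw [pathPrev, dif_neg hz]

/-- **RE-ROOTING**: a rooted parent structure on `V`, re-rooted at any vertex `c ∈ V` (the path from `c` to the old root
reversed), is a rooted parent structure on `V` with root `c`. [folklore] -/
private theorem reroot (h : RootedOn V r p φ) (hc : c ∈ V) :
    RootedOn V c (rerootP p c (pathLen p c r)) (rerootR p φ c (pathLen p c r)) := by
  set J := pathLen p c r with hJ
  have hr : OnPath p c J r := ⟨J, le_rfl, h.iter_pathLen hc⟩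
  refine ⟨hc, fun z hz hzc => ?_, fun z hz hzc => ?_⟩
  · by_cases hon : OnPath p c J z
    · obtain ⟨j, hj, rfl⟩ := hon
      rw [h.rerootP_iter hc hj]
      exact h.iter_mem hc (by omega)
    · rw [rerootP_of_not hon]
      exact h.parent_mem z hz (fun e => hon (e ▸ hr))
  · by_cases hon : OnPath p c J z
    · obtain ⟨j, hj, rfl⟩ := hon
      have hj0 : j ≠ 0 := by rintro rfl; exact hzc rfl
      rw [h.rerootP_iter hc hj, h.rerootR_iter hc hj, h.rerootR_iter hc (by omega : j - 1 ≤ J)]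
      omega
    · have hzr : z ≠ r := fun e => hon (e ▸ hr)
      rw [rerootP_of_not hon, rerootR_of_not hon]
      by_cases hon' : OnPath p c J (p z)
      · obtain ⟨j, hj, hpz⟩ := hon'
        rw [← hpz, h.rerootR_iter hc hj]
        omega
      · rw [rerootR_of_not hon']
        have := h.rank_lt z hz hzr
        omega

/-- EDGES OF THE RE-ROOTED STRUCTURE ARE OLD EDGES: for `z ≠ c` the new parent edge `{z, p′ z}` is the old parent
edge `{w, p w}` of `w = pathPrev z ∈ V ∖ {r}`. [folklore] -/
private theorem pathPrev_spec (h : RootedOn V r p φ) (hc : c ∈ V) {z : α} (hz : z ∈ V) (hzc : z ≠ c) :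
    pathPrev p c (pathLen p c r) z ∈ V ∧ pathPrev p c (pathLen p c r) z ≠ r ∧
      ((z = pathPrev p c (pathLen p c r) z ∧ rerootP p c (pathLen p c r) z = p (pathPrev p c (pathLen p c r) z)) ∨
        (z = p (pathPrev p c (pathLen p c r) z) ∧ rerootP p c (pathLen p c r) z = pathPrev p c (pathLen p c r) z)) := by
  set J := pathLen p c r with hJ
  by_cases hon : OnPath p c J z
  · obtain ⟨j, hj, rfl⟩ := hon
    have hj0 : j ≠ 0 := by rintro rfl; exact hzc rfl
    rw [h.pathPrev_iter hc hj, h.rerootP_iter hc hj]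
    refine ⟨h.iter_mem hc (by omega), h.iter_ne_root hc (by omega), Or.inr ⟨?_, rfl⟩⟩
    rw [← Function.iterate_succ_apply' p (j - 1) c]
    congr 1; omega
  · have hr : OnPath p c J r := ⟨J, le_rfl, h.iter_pathLen hc⟩
    rw [pathPrev_of_not hon, rerootP_of_not hon]
    exact ⟨hz, fun e => hon (e ▸ hr), Or.inl ⟨rfl, rfl⟩⟩

/-- … and OLD EDGES ARE EDGES OF THE RE-ROOTED STRUCTURE: every `w ∈ V ∖ {r}` is `pathPrev z` for some
`z ∈ V ∖ {c}`. [folklore] -/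
private theorem exists_pathPrev_eq (h : RootedOn V r p φ) (hc : c ∈ V) {w : α} (hw : w ∈ V) (hwr : w ≠ r) :
    ∃ z, z ∈ V ∧ z ≠ c ∧ pathPrev p c (pathLen p c r) z = w := by
  set J := pathLen p c r with hJ
  by_cases hon : OnPath p c J w
  · obtain ⟨i, hi, rfl⟩ := hon
    have hiJ : i < J := by
      rcases Nat.lt_or_ge i J with hlt | hge
      · exact hlt
      · exfalso; apply hwr
        have : i = J := le_antisymm hi hge
        rw [this]; exact h.iter_pathLen hc
    refine ⟨p^[i + 1] c, h.iter_mem hc (by omega), fun e => ?_, ?_⟩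
    · have := h.iter_inj hc (by omega : i + 1 ≤ J) (Nat.zero_le _) (by simpa using e)
      omega
    · rw [h.pathPrev_iter hc (by omega : i + 1 ≤ J), Nat.add_sub_cancel]
  · have hc0 : OnPath p c J c := ⟨0, Nat.zero_le _, rfl⟩
    exact ⟨w, hw, fun e => hon (e ▸ hc0), pathPrev_of_not hon⟩

/-- TAGGING: a rooted parent structure on lattice points, read on the points tagged with a layer index `i`. [folklore] -/
private theorem tag {V : Finset α} {r : α} {p : α → α} {φ : α → ℕ} (h : RootedOn V r p φ) (i : ℕ) :
    RootedOn (V.image (Prod.mk i)) (i, r) (fun x : ℕ × α => (i, p x.2)) (fun x => φ x.2) := by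
  refine ⟨Finset.mem_image_of_mem _ h.root_mem, fun x hx hxr => ?_, fun x hx hxr => ?_⟩
  · obtain ⟨z, hz, rfl⟩ := Finset.mem_image.1 hx
    have hzr : z ≠ r := fun e => hxr (by rw [e])
    exact Finset.mem_image_of_mem _ (h.parent_mem z hz hzr)
  · obtain ⟨z, hz, rfl⟩ := Finset.mem_image.1 hx
    have hzr : z ≠ r := fun e => hxr (by rw [e])
    exact h.rank_lt z hz hzr

end RootedOn

end Reroot

/-! ### §9b  An abstract bridge for graphs given by sets of ordered pairs -/

section PairBridge

variable {β : Type*} {V : Finset β} {r : β} {P : β → β} {pb : β → β × β} {E : Finset (β × β)}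

/-- The graph on `V` of a set `E` of ordered pairs (bonds with both ends recorded). [folklore] -/
private def pairGraph (E : Finset (β × β)) (V : Finset β) : SimpleGraph ↥V :=
  SimpleGraph.fromRel fun v w : ↥V => ((v : β), (w : β)) ∈ E

/-- Adjacency in the graph of `E`. [folklore] -/
private theorem pairGraph_adj {v w : ↥V} :
    (pairGraph E V).Adj v w ↔ v ≠ w ∧ (((v : β), (w : β)) ∈ E ∨ ((w : β), (v : β)) ∈ E) := by
  rw [pairGraph, SimpleGraph.fromRel_adj]

/-- If `E` is exactly the set of the pairs `pb z`, `z ∈ V ∖ {r}`, each joining `z` to `P z`, then the graph of `E` on `V`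
is the parent graph of `P`. [folklore] -/
private theorem pairGraph_eq_parentGraph
    (hjoin : ∀ z ∈ V, z ≠ r → pb z = (P z, z) ∨ pb z = (z, P z))
    (hE : ∀ b, b ∈ E ↔ ∃ z ∈ V, z ≠ r ∧ pb z = b) : pairGraph E V = parentGraph V r P := by
  ext v w
  rw [pairGraph_adj, parentGraph_adj]
  refine and_congr_right fun _ => ⟨?_, ?_⟩
  · rintro (hb | hb)
    · obtain ⟨z, hz, hzr, e⟩ := (hE _).1 hb
      rcases hjoin z hz hzr with e' | e'
      · rw [e'] at e
        obtain ⟨e1, e2⟩ := Prod.mk.inj e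
        right; exact ⟨by rw [← e2]; exact hzr, by rw [← e2]; exact e1⟩
      · rw [e'] at e
        obtain ⟨e1, e2⟩ := Prod.mk.inj e
        left; exact ⟨by rw [← e1]; exact hzr, by rw [← e1]; exact e2⟩
    · obtain ⟨z, hz, hzr, e⟩ := (hE _).1 hb
      rcases hjoin z hz hzr with e' | e'
      · rw [e'] at e
        obtain ⟨e1, e2⟩ := Prod.mk.inj e
        left; exact ⟨by rw [← e2]; exact hzr, by rw [← e2]; exact e1⟩
      · rw [e'] at e
        obtain ⟨e1, e2⟩ := Prod.mk.inj e
        right; exact ⟨by rw [← e1]; exact hzr, by rw [← e1]; exact e2⟩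
  · rintro (⟨hv, hpv⟩ | ⟨hw, hpw⟩)
    · have hb : pb v ∈ E := (hE _).2 ⟨v, v.2, hv, rfl⟩
      rcases hjoin v v.2 hv with e' | e'
      · right; rw [e', hpv] at hb; exact hb
      · left; rw [e', hpv] at hb; exact hb
    · have hb : pb w ∈ E := (hE _).2 ⟨w, w.2, hw, rfl⟩
      rcases hjoin w w.2 hw with e' | e'
      · left; rw [e', hpw] at hb; exact hb
      · right; rw [e', hpw] at hb; exact hb

/-- … and then `|E| + 1 = |V|`. [folklore] -/
private theorem card_of_pairs [DecidableEq β] {φ : β → ℕ} (h : RootedOn V r P φ)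
    (hjoin : ∀ z ∈ V, z ≠ r → pb z = (P z, z) ∨ pb z = (z, P z))
    (hE : ∀ b, b ∈ E ↔ ∃ z ∈ V, z ≠ r ∧ pb z = b) : E.card + 1 = V.card := by
  have hEeq : E = (V.erase r).image pb := by
    ext b
    rw [hE b, Finset.mem_image]
    constructor
    · rintro ⟨z, hz, hzr, e⟩; exact ⟨z, Finset.mem_erase.2 ⟨hzr, hz⟩, e⟩
    · rintro ⟨z, hz, e⟩
      exact ⟨z, (Finset.mem_erase.1 hz).2, (Finset.mem_erase.1 hz).1, e⟩
  have hinj : Set.InjOn pb ↑(V.erase r) := by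
    intro z hz z' hz' e
    obtain ⟨hzr, hz⟩ := Finset.mem_erase.1 (Finset.mem_coe.1 hz)
    obtain ⟨hz'r, hz'⟩ := Finset.mem_erase.1 (Finset.mem_coe.1 hz')
    refine h.eq_of_pair_eq hz hzr hz' hz'r ?_
    have E1 := hjoin z hz hzr
    have E2 := hjoin z' hz' hz'r
    rw [e] at E1
    rcases E1 with a1 | a1 <;> rcases E2 with a2 | a2
    · have := Prod.mk.inj (a1.symm.trans a2); exact Or.inl ⟨this.2, this.1⟩
    · have := Prod.mk.inj (a1.symm.trans a2); exact Or.inr ⟨this.2, this.1⟩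
    · have := Prod.mk.inj (a1.symm.trans a2); exact Or.inr ⟨this.1, this.2⟩
    · have := Prod.mk.inj (a1.symm.trans a2); exact Or.inl ⟨this.1, this.2⟩
  rw [hEeq, Finset.card_image_of_injOn hinj, Finset.card_erase_of_mem h.root_mem]
  have := Finset.card_pos.2 ⟨r, h.root_mem⟩
  omega

end PairBridge

/-! ### §9c  The multi-scale model of `T₀` -/

section MultiScale

/-- The points of the multi-scale picture: a lattice point TAGGED with the index `i` of its layer `P^i ∖ P^{i+1}`, each
layer being read on its own unit lattice (p. 195 «We may assume, rescaling properly, that it is the unit lattice»).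
[cite: Balaban1989LargeFieldI, p.196] -/
abbrev MPt (n : ℕ) := ℕ × LPt n

variable {L U L' U' : ℕ → LPt n} {A : ℕ → ℤ} {uC cC : ℕ → LPt n}

/-- The HYPOTHESES of the multi-scale model: the `i`-th layer is the admissible annulus
`P^i ∖ P^{i+1} = [L i, U i] ∖ [L′ i, U′ i]` (in the coordinates of the `i`-th lattice, threshold `A i`); the OUTER end
`u_{i+1}` of the external bond of `P^{i+1}` (print's `(a′₁ − 1/2, a′₂ + 1/2, …, a′_d + 1/2)`) is a point of the layer
`i`, its INNER end `c_{i+1}` (the point of `P^{i+1} ∖ P^{i+2}` under `(a′₁ + 1/2, a′₂ + 1/2, …, a′_d + 1/2)`) a point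
of the layer `i + 1`.  The positions of `u`, `c` are parameters: they play no role in the tree property.
[cite: Balaban1989LargeFieldI, p.196] -/
structure MChain (m : ℕ) (L U L' U' : ℕ → LPt n) (A : ℕ → ℤ) (uC cC : ℕ → LPt n) : Prop where
  adm : ∀ i, i < m → Adm (L i) (U i) (L' i) (U' i) (A i)
  conn_mem : ∀ i, i + 1 < m → uC (i + 1) ∈ ann (L i) (U i) (L' i) (U' i)
  cent_mem : ∀ i, i + 1 < m → cC (i + 1) ∈ ann (L (i + 1)) (U (i + 1)) (L' (i + 1)) (U' (i + 1))

/-- A multi-scale chain restricts to its first `m` layers. [cite: Balaban1989LargeFieldI, p.196] -/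
theorem MChain.mono {m : ℕ} (h : MChain (m + 1) L U L' U' A uC cC) : MChain m L U L' U' A uC cC :=
  ⟨fun i hi => h.adm i (Nat.lt_succ_of_lt hi), fun i hi => h.conn_mem i (Nat.lt_succ_of_lt hi),
    fun i hi => h.cent_mem i (Nat.lt_succ_of_lt hi)⟩

/-- The `i`-th layer, tagged. [cite: Balaban1989LargeFieldI, p.196] -/
noncomputable def mlayer (L U L' U' : ℕ → LPt n) (i : ℕ) : Finset (MPt n) :=
  (ann (L i) (U i) (L' i) (U' i)).image (Prod.mk i)

/-- The outer end `y − e₁` of the `Λ`-bond, tagged with the layer `0` (it is a point of the unit lattice of `Λ`,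
outside `Λ`). [cite: Balaban1989LargeFieldI, p.196] -/
noncomputable def mroot (L : ℕ → LPt n) : MPt n := (0, outRoot L)

/-- The INNER end of the `i`-th external bond: `y = l^0` for the `Λ`-bond, `c_i` for `i ≥ 1`.
[cite: Balaban1989LargeFieldI, p.196] -/
def cIn (L cC : ℕ → LPt n) : ℕ → LPt n
  | 0 => L 0
  | i + 1 => cC (i + 1)

/-- The OUTER end of the `i`-th external bond, tagged: `y − e₁` for the `Λ`-bond, `u_i ∈ P^{i−1} ∖ P^i` for `i ≥ 1`.
[cite: Balaban1989LargeFieldI, p.196] -/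
noncomputable def cOut (L uC : ℕ → LPt n) : ℕ → MPt n
  | 0 => mroot L
  | i + 1 => (i, uC (i + 1))

/-- The `i`-th EXTERNAL BOND of the multi-scale `T₀`: *"[(y₁ − 1, y₂, …, y_d), y]"* for `i = 0`,
*"[(a′₁ − 1/2, a′₂ + 1/2, …, a′_d + 1/2), (a′₁ + 1/2, a′₂ + 1/2, …, a′_d + 1/2)]"* (joining the layers `i − 1` and `i`)
for `i ≥ 1`. [cite: Balaban1989LargeFieldI, p.196] -/
noncomputable def mext (L uC cC : ℕ → LPt n) (i : ℕ) : MPt n × MPt n := (cOut L uC i, (i, cIn L cC i))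

/-- A bond of the `i`-th lattice, tagged (both ends recorded). [cite: Balaban1989LargeFieldI, p.196] -/
def tagB (i : ℕ) (b : LBond n) : MPt n × MPt n := ((i, b.1), (i, b.hi))

/-- The sites carrying the multi-scale `T₀`: the tagged layers and the outer end of the `Λ`-bond.
[cite: Balaban1989LargeFieldI, p.196] -/
noncomputable def msites (L U L' U' : ℕ → LPt n) (m : ℕ) : Finset (MPt n) :=
  {mroot L} ∪ (Finset.range m).biUnion (mlayer L U L' U')

/-- **`T₀`, MULTI-SCALE MODEL**, verbatim *"The union of the above described tree graphs and bonds is denoted by T₀"*: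
the tagged trees of the layers and the external bonds between consecutive layers. [cite: Balaban1989LargeFieldI, p.196] -/
noncomputable def MT0 (L U L' U' : ℕ → LPt n) (A : ℕ → ℤ) (uC cC : ℕ → LPt n) (m : ℕ) : Finset (MPt n × MPt n) :=
  (Finset.range m).biUnion (fun i => (tree (L i) (U i) (L' i) (U' i) (A i)).image (tagB i)) ∪
    (Finset.range m).image (mext L uC cC)

/-- One more layer: the sites. [cite: Balaban1989LargeFieldI, p.196] -/
theorem msites_succ (L U L' U' : ℕ → LPt n) (m : ℕ) :
    msites L U L' U' (m + 1) = msites L U L' U' m ∪ mlayer L U L' U' m := by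
  rw [msites, msites, Finset.range_add_one, Finset.biUnion_insert, Finset.union_comm (mlayer L U L' U' m),
    Finset.union_assoc]

/-- One more layer: the bonds. [cite: Balaban1989LargeFieldI, p.196] -/
theorem MT0_succ (L U L' U' : ℕ → LPt n) (A : ℕ → ℤ) (uC cC : ℕ → LPt n) (m : ℕ) :
    MT0 L U L' U' A uC cC (m + 1) =
      MT0 L U L' U' A uC cC m ∪ (tree (L m) (U m) (L' m) (U' m) (A m)).image (tagB m) ∪ {mext L uC cC m} := by
  ext b
  simp only [MT0, Finset.range_add_one, Finset.biUnion_insert, Finset.image_insert, Finset.mem_union,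
    Finset.mem_insert, Finset.mem_singleton]
  tauto

/-- No bonds for the empty chain. [cite: Balaban1989LargeFieldI, p.196] -/
theorem MT0_zero (L U L' U' : ℕ → LPt n) (A : ℕ → ℤ) (uC cC : ℕ → LPt n) : MT0 L U L' U' A uC cC 0 = ∅ := by
  simp [MT0]

/-- One site (the outer root) for the empty chain. [cite: Balaban1989LargeFieldI, p.196] -/
theorem msites_zero (L U L' U' : ℕ → LPt n) : msites L U L' U' 0 = {mroot L} := by
  simp [msites]

/-- The outer root is not a point of any tagged layer. [cite: Balaban1989LargeFieldI, p.196] -/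
theorem mroot_not_mem_mlayer (L U L' U' : ℕ → LPt n) (i : ℕ) : mroot L ∉ mlayer L U L' U' i := by
  intro hmem
  rw [mlayer, Finset.mem_image] at hmem
  obtain ⟨z, hz, e⟩ := hmem
  rw [mroot] at e
  obtain ⟨rfl, rfl⟩ := Prod.mk.inj e
  have hzm : outRoot L ∈ box (L 0) (U 0) := (mem_ann.1 hz).1
  rw [mem_box] at hzm
  have := (hzm 0).1
  rw [outRoot, sub_unitVec_self] at this
  omega

/-- The new tagged layer is disjoint from the sites already present (different tags; the outer root lies outside `Λ`).
[cite: Balaban1989LargeFieldI, p.196] -/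
theorem disjoint_msites_mlayer (L U L' U' : ℕ → LPt n) (m : ℕ) :
    Disjoint (msites L U L' U' m) (mlayer L U L' U' m) := by
  rw [Finset.disjoint_left]
  intro x hx hx'
  rw [msites, Finset.mem_union, Finset.mem_singleton, Finset.mem_biUnion] at hx
  rcases hx with rfl | ⟨i, hi, hxi⟩
  · exact mroot_not_mem_mlayer L U L' U' m hx'
  · rw [Finset.mem_range] at hi
    rw [mlayer, Finset.mem_image] at hxi hx'
    obtain ⟨z, -, rfl⟩ := hxi
    obtain ⟨z', -, e⟩ := hx'
    have := (Prod.mk.inj e).1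
    omega

/-- The inner end of the new external bond lies in the new layer. [cite: Balaban1989LargeFieldI, p.196] -/
theorem MChain.cIn_mem {m : ℕ} (h : MChain (m + 1) L U L' U' A uC cC) :
    cIn L cC m ∈ ann (L m) (U m) (L' m) (U' m) := by
  cases m with
  | zero => exact (h.adm 0 (Nat.zero_lt_succ 0)).root_mem
  | succ i => exact h.cent_mem i (Nat.lt_succ_self _)

/-- The outer end of the new external bond is a site already present. [cite: Balaban1989LargeFieldI, p.196] -/
theorem MChain.cOut_mem {m : ℕ} (h : MChain (m + 1) L U L' U' A uC cC) : cOut L uC m ∈ msites L U L' U' m := by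
  cases m with
  | zero => rw [msites_zero, cOut]; exact Finset.mem_singleton_self _
  | succ i =>
    rw [msites_succ, cOut]
    exact Finset.mem_union_right _ (Finset.mem_image_of_mem _ (h.conn_mem i (Nat.lt_succ_self _)))

/-- The parent map of the `m`-th layer RE-ROOTED at the inner end `cIn m` of its external bond (§9a).
[cite: Balaban1989LargeFieldI, p.196] -/
private noncomputable def lP (L U : ℕ → LPt n) (A : ℕ → ℤ) (cC : ℕ → LPt n) (m : ℕ) : LPt n → LPt n :=
  rerootP (par (L m) (U m) (A m)) (cIn L cC m) (pathLen (par (L m) (U m) (A m)) (cIn L cC m) (L m))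

/-- Its rank. [cite: Balaban1989LargeFieldI, p.196] -/
private noncomputable def lR (L U : ℕ → LPt n) (A : ℕ → ℤ) (cC : ℕ → LPt n) (m : ℕ) : LPt n → ℕ :=
  rerootR (par (L m) (U m) (A m)) (rank (L m) (U m) (A m)) (cIn L cC m)
    (pathLen (par (L m) (U m) (A m)) (cIn L cC m) (L m))

/-- The point of the `m`-th layer whose (old) parent bond enters a given point in the re-rooted tree (§9a `pathPrev`).
[cite: Balaban1989LargeFieldI, p.196] -/
private noncomputable def lW (L U : ℕ → LPt n) (A : ℕ → ℤ) (cC : ℕ → LPt n) (m : ℕ) : LPt n → LPt n :=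
  pathPrev (par (L m) (U m) (A m)) (cIn L cC m) (pathLen (par (L m) (U m) (A m)) (cIn L cC m) (L m))

/-- The glued parent map of the multi-scale `T₀` (recursively over the layers, each re-rooted at `cIn i` and attached
at `cOut i`). [cite: Balaban1989LargeFieldI, p.196] -/
private noncomputable def MP (L U L' U' : ℕ → LPt n) (A : ℕ → ℤ) (uC cC : ℕ → LPt n) : ℕ → MPt n → MPt n
  | 0 => fun x => x
  | m + 1 => glueP (mlayer L U L' U' m) (m, cIn L cC m) (cOut L uC m) (MP L U L' U' A uC cC m)
      (fun x => (m, lP L U A cC m x.2))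

/-- The glued rank of the multi-scale `T₀`. [cite: Balaban1989LargeFieldI, p.196] -/
private noncomputable def MR (L U L' U' : ℕ → LPt n) (A : ℕ → ℤ) (uC cC : ℕ → LPt n) : ℕ → MPt n → ℕ
  | 0 => fun _ => 0
  | m + 1 => glueR (msites L U L' U' m) (mlayer L U L' U' m) (MR L U L' U' A uC cC m) (fun x => lR L U A cC m x.2)

/-- The bond of the multi-scale `T₀` entering a site: the external bond at an inner end `cIn i`, otherwise the tagged
tree bond owned (after re-rooting) by the site. [cite: Balaban1989LargeFieldI, p.196] -/
private noncomputable def pbm (L U L' U' : ℕ → LPt n) (A : ℕ → ℤ) (uC cC : ℕ → LPt n) : ℕ → MPt n → MPt n × MPt n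
  | 0 => fun x => (x, x)
  | m + 1 => fun x => if x ∈ mlayer L U L' U' m then
      (if x.2 = cIn L cC m then mext L uC cC m
        else tagB m (pbond (L m) (U m) (A m) (lW L U A cC m x.2)))
      else pbm L U L' U' A uC cC m x

/-- The multi-scale `T₀` rooted at the outer end of the `Λ`-bond: the glued, re-rooted parent structure.
[cite: Balaban1989LargeFieldI, p.196] -/
private theorem mrooted : ∀ {m : ℕ}, MChain m L U L' U' A uC cC →
    RootedOn (msites L U L' U' m) (mroot L) (MP L U L' U' A uC cC m) (MR L U L' U' A uC cC m)
  | 0, _ => ⟨by simp [msites_zero], fun z hz hzr => by simp [msites_zero] at hz; exact absurd hz hzr,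
      fun z hz hzr => by simp [msites_zero] at hz; exact absurd hz hzr⟩
  | m + 1, h => by
    rw [msites_succ]
    have hl : RootedOn (mlayer L U L' U' m) (m, cIn L cC m) (fun x : MPt n => (m, lP L U A cC m x.2))
        (fun x => lR L U A cC m x.2) :=
      ((rooted (h.adm m (Nat.lt_succ_self m))).reroot h.cIn_mem).tag m
    exact (mrooted h.mono).glue hl (disjoint_msites_mlayer L U L' U' m) h.cOut_mem

/-- Every bond `pbm x` joins `x` to its glued parent. [cite: Balaban1989LargeFieldI, p.196] -/
private theorem pbm_joins : ∀ {m : ℕ}, MChain m L U L' U' A uC cC → ∀ x ∈ msites L U L' U' m, x ≠ mroot L →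
    pbm L U L' U' A uC cC m x = (MP L U L' U' A uC cC m x, x) ∨
      pbm L U L' U' A uC cC m x = (x, MP L U L' U' A uC cC m x)
  | 0, _, x, hx, hxr => by simp [msites_zero] at hx; exact absurd hx hxr
  | m + 1, h, x, hx, hxr => by
    by_cases hxl : x ∈ mlayer L U L' U' m
    · obtain ⟨z, hz, rfl⟩ : ∃ z ∈ ann (L m) (U m) (L' m) (U' m), (m, z) = x := by
        simpa [mlayer] using hxl
      simp only [pbm, MP, glueP]
      rw [if_pos hxl, if_pos hxl]
      by_cases hzc : z = cIn L cC m
      · rw [if_pos hzc, if_pos (by rw [hzc])]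
        left
        rw [mext, hzc]
      · rw [if_neg hzc, if_neg (fun e => hzc (Prod.mk.inj e).2)]
        have hadm := h.adm m (Nat.lt_succ_self m)
        have hor : (z = lW L U A cC m z ∧ lP L U A cC m z = par (L m) (U m) (A m) (lW L U A cC m z)) ∨
            (z = par (L m) (U m) (A m) (lW L U A cC m z) ∧ lP L U A cC m z = lW L U A cC m z) :=
          ((rooted hadm).pathPrev_spec h.cIn_mem hz hzc).2.2
        have hends := pbond_ends (L m) (U m) (A m) (lW L U A cC m z)
        simp only [tagB]
        rcases hor with ⟨e1, e2⟩ | ⟨e1, e2⟩ <;> rcases hends with ⟨f1, f2⟩ | ⟨f1, f2⟩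
        · left; rw [f1, f2, e2, ← e1]
        · right; rw [f1, f2, e2, ← e1]
        · right; rw [f1, f2, e2, ← e1]
        · left; rw [f1, f2, e2, ← e1]
    · simp only [pbm, MP, glueP]
      rw [if_neg hxl, if_neg hxl]
      have hx' : x ∈ msites L U L' U' m := by
        rw [msites_succ, Finset.mem_union] at hx
        exact hx.resolve_right hxl
      exact pbm_joins h.mono x hx' hxr

/-- The multi-scale `T₀` IS the set of the bonds `pbm x` over its sites other than the outer root.
[cite: Balaban1989LargeFieldI, p.196] -/
private theorem mem_MT0_iff : ∀ {m : ℕ}, MChain m L U L' U' A uC cC → ∀ b,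
    b ∈ MT0 L U L' U' A uC cC m ↔ ∃ x ∈ msites L U L' U' m, x ≠ mroot L ∧ pbm L U L' U' A uC cC m x = b
  | 0, _, b => by
    simp only [MT0_zero, Finset.notMem_empty, msites_zero, Finset.mem_singleton, false_iff, not_exists,
      not_and]
    intro x hx hxr; exact absurd hx hxr
  | m + 1, h, b => by
    have ih := mem_MT0_iff h.mono
    have hadm := h.adm m (Nat.lt_succ_self m)
    have hrt := (rooted hadm)
    have hcIn := h.cIn_mem
    have hdisj := disjoint_msites_mlayer L U L' U' m
    have hnot : ∀ {x}, x ∈ msites L U L' U' m → x ∉ mlayer L U L' U' m :=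
      fun hx hx' => Finset.disjoint_left.1 hdisj hx hx'
    have hml : ∀ {z}, z ∈ ann (L m) (U m) (L' m) (U' m) → ((m, z) : MPt n) ∈ mlayer L U L' U' m :=
      fun hz => Finset.mem_image_of_mem _ hz
    have hne : ∀ {z}, z ∈ ann (L m) (U m) (L' m) (U' m) → ((m, z) : MPt n) ≠ mroot L :=
      fun hz e => mroot_not_mem_mlayer L U L' U' m (e ▸ hml hz)
    rw [MT0_succ, Finset.mem_union, Finset.mem_union, Finset.mem_singleton, ih,
      tree_eq_image hadm, Finset.image_image, Finset.mem_image]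
    constructor
    · rintro ((⟨x, hx, hxr, e⟩ | ⟨w, hw, e⟩) | rfl)
      · refine ⟨x, by rw [msites_succ]; exact Finset.mem_union_left _ hx, hxr, ?_⟩
        simp only [pbm]; rw [if_neg (hnot hx)]; exact e
      · obtain ⟨hwl, hw'⟩ := Finset.mem_erase.1 hw
        obtain ⟨z, hz, hzc, hzw⟩ := hrt.exists_pathPrev_eq hcIn hw' hwl
        refine ⟨(m, z), by rw [msites_succ]; exact Finset.mem_union_right _ (hml hz), hne hz, ?_⟩
        simp only [pbm]
        rw [if_pos (hml hz), if_neg hzc]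
        simp only [Function.comp] at e
        rw [← e, lW, hzw]
      · refine ⟨(m, cIn L cC m), by rw [msites_succ]; exact Finset.mem_union_right _ (hml hcIn), hne hcIn, ?_⟩
        simp only [pbm]
        rw [if_pos (hml hcIn), if_pos trivial]
    · rintro ⟨x, hx, hxr, e⟩
      simp only [pbm] at e
      by_cases hxl : x ∈ mlayer L U L' U' m
      · rw [if_pos hxl] at e
        obtain ⟨z, hz, rfl⟩ : ∃ z ∈ ann (L m) (U m) (L' m) (U' m), (m, z) = x := by
          simpa [mlayer] using hxl
        by_cases hzc : z = cIn L cC m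
        · rw [if_pos hzc] at e; right; exact e.symm
        · rw [if_neg hzc] at e
          obtain ⟨hwm, hwl, -⟩ := hrt.pathPrev_spec hcIn hz hzc
          left; right
          exact ⟨lW L U A cC m z, Finset.mem_erase.2 ⟨hwl, hwm⟩, e⟩
      · rw [if_neg hxl] at e
        have hx' : x ∈ msites L U L' U' m := by
          rw [msites_succ, Finset.mem_union] at hx; exact hx.resolve_right hxl
        left; left; exact ⟨x, hx', hxr, e⟩

/-- **p. 196, `T₀` IS A TREE — MULTI-SCALE MODEL**, verbatim *"The union of the above described tree graphs and bonds is
denoted by T₀. It is a tree graph in 𝔹₀"*: with the layers on their own lattices (tagged sites), the trees of §3 in the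
layers, the external bonds `⟨u_i, c_i⟩` between ARBITRARY points `u_i ∈ P^{i−1} ∖ P^i`, `c_i ∈ P^i ∖ P^{i+1}` (in
print: the two unit-cube centres straddling the corner of `∂P^i`) and the `Λ`-bond `⟨y − e₁, y⟩`, the graph of `T₀` on
the sites `⋃_i (P^i ∖ P^{i+1}) ∪ {y − e₁}` is a tree. [cite: Balaban1989LargeFieldI, p.196] -/
theorem MT0_isTree {m : ℕ} (h : MChain m L U L' U' A uC cC) :
    (pairGraph (MT0 L U L' U' A uC cC m) (msites L U L' U' m)).IsTree := by
  rw [pairGraph_eq_parentGraph (pbm_joins h) (mem_MT0_iff h)]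
  exact (mrooted h).isTree

/-- `|T₀| + 1 = |sites|` (multi-scale model). [cite: Balaban1989LargeFieldI, p.196] -/
theorem card_MT0 {m : ℕ} (h : MChain m L U L' U' A uC cC) :
    (MT0 L U L' U' A uC cC m).card + 1 = (msites L U L' U' m).card :=
  card_of_pairs (mrooted h) (pbm_joins h) (mem_MT0_iff h)

/-- **p. 196**, verbatim *"fixing completely a gauge in this set"* — the count behind it, multi-scale model: `T₀` has
exactly as many bonds as there are sites in the layers (one per gauge degree of freedom used; the outer end `y − e₁`
carries none). [cite: Balaban1989LargeFieldI, p.196] -/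
theorem card_MT0_eq {m : ℕ} (h : MChain m L U L' U' A uC cC) :
    (MT0 L U L' U' A uC cC m).card = ((Finset.range m).biUnion (mlayer L U L' U')).card := by
  have hc := card_MT0 h
  have hr : mroot L ∉ (Finset.range m).biUnion (mlayer L U L' U') := by
    intro hmem
    rw [Finset.mem_biUnion] at hmem
    obtain ⟨i, -, hz⟩ := hmem
    exact mroot_not_mem_mlayer L U L' U' i hz
  rw [msites, Finset.card_union_of_disjoint (Finset.disjoint_singleton_left.2 hr), Finset.card_singleton] at hc
  omega

/-- The layers being read each on its own lattice, the number of sites is the SUM of the layer sizes.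
[cite: Balaban1989LargeFieldI, p.196] -/
theorem card_MT0_eq_sum {m : ℕ} (h : MChain m L U L' U' A uC cC) :
    (MT0 L U L' U' A uC cC m).card = ∑ i ∈ Finset.range m, (ann (L i) (U i) (L' i) (U' i)).card := by
  rw [card_MT0_eq h, Finset.card_biUnion]
  · refine Finset.sum_congr rfl fun i _ => ?_
    rw [mlayer, Finset.card_image_of_injective]
    exact fun z z' e => (Prod.mk.inj e).2
  · intro i _ j _ hij
    rw [Function.onFun, Finset.disjoint_left]
    intro x hx hx'
    rw [mlayer, Finset.mem_image] at hx hx'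
    obtain ⟨z, -, rfl⟩ := hx
    obtain ⟨z', -, e⟩ := hx'
    exact hij (Prod.mk.inj e).1.symm

/-- The single-scale model of §8 is the special case `L′ i = L (i+1)`, `U′ i = U (i+1)`, `u_{i+1} = l^{i+1} − e₁`,
`c_{i+1} = l^{i+1}` of the multi-scale hypotheses. [cite: Balaban1989LargeFieldI, p.196] -/
theorem Chain.toMChain {L U : ℕ → LPt n} {A : ℕ → ℤ} {m : ℕ} (h : Chain m L U A) :
    MChain m L U (fun i => L (i + 1)) (fun i => U (i + 1)) A (fun i => L i - unitVec 0) L := by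
  refine ⟨h.adm, fun i hi => ?_, fun i hi => (h.adm (i + 1) hi).root_mem⟩
  have h2 : Chain (i + 2) L U A :=
    ⟨fun j hj => h.adm j (by omega), fun j hj => h.nest j (by omega)⟩
  have hmem := h2.conn_mem_sites
  have hdisj := h2.mono.disjoint_sites_layer
  -- `l^{i+1} − e₁ ∈ sites (i+1) = sites i ∪ layer i`, and it is not in `sites i`… we show it lies in `layer i` directly
  rw [sites_succ, Finset.mem_union] at hmem
  rcases hmem with hold | hnew
  · -- a site of `sites L U i` lies outside the box `P^{i}`… but `l^{i+1} − e₁ ∈ P^i`: contradiction via the layer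
    exfalso
    have ha := h.adm (i + 1) hi
    have hn := h.nest i (by omega)
    have hbox : L (i + 1) - unitVec 0 ∈ box (L i) (U i) := by
      rw [mem_box]; intro q
      by_cases hq : q = 0
      · rw [hq, sub_unitVec_self]
        have := ha.low₁; have := (h.nest i (by omega)) 0; have := ha.le 0
        have := (h.adm i (by omega)).low₁; have := (h.adm i (by omega)).thr₁
        have := (h.adm i (by omega)).thr₂; have := (h.adm i (by omega)).high₁
        exact ⟨by omega, by omega⟩
      · rw [sub_unitVec_ne _ hq]
        have := hn q
        exact ⟨this.1, le_trans this.2.1 this.2.2⟩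
    rw [sites, Finset.mem_union, Finset.mem_singleton, Finset.mem_biUnion] at hold
    rcases hold with e | ⟨j, hj, hzj⟩
    · rw [mem_box] at hbox
      have h0 := h.box_subset (Nat.zero_le i) (by omega : i ≤ m)
      have := (mem_box.1 (h0 (mem_box.2 hbox)) 0).1
      rw [e, outRoot, sub_unitVec_self] at this
      omega
    · rw [Finset.mem_range] at hj
      have hsub := h.box_subset (i := j + 1) (j := i) (by omega) (by omega) hbox
      exact (mem_ann.1 hzj).2 hsub
  · exact hnew

end MultiScale

/-! Non-vacuity of `MChain`: two layers on their own lattices (d = 2) — `Λ`-layer `[0,6]² ∖ [3,4]×[2,3]` (a = 3) and,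
one scale down, `[0,9]² ∖ [4,5]×[3,4]` (a = 4), joined by the bond `⟨(2,3), (1,1)⟩` between the two lattices. -/

example : MChain (n := 0) 2 (fun _ => ![0, 0]) (fun i => if i = 0 then ![6, 6] else ![9, 9])
    (fun i => if i = 0 then ![3, 2] else ![4, 3]) (fun i => if i = 0 then ![4, 3] else ![5, 4])
    (fun i => if i = 0 then 3 else 4) (fun _ => ![2, 3]) (fun _ => ![1, 1]) := by
  refine ⟨fun i hi => ?_, fun i hi => ?_, fun i hi => ?_⟩
  · rcases Nat.lt_succ_iff_lt_or_eq.1 hi with hi | rfl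
    · obtain rfl : i = 0 := by omega
      refine ⟨fun j => ?_, ?_, ?_, ?_, ?_, ?_⟩
      · fin_cases j <;> simp
      all_goals simp
    · refine ⟨fun j => ?_, ?_, ?_, ?_, ?_, ?_⟩
      · fin_cases j <;> simp
      all_goals simp
  · obtain rfl : i = 0 := by omega
    rw [mem_ann, mem_box, mem_box]
    refine ⟨fun j => ?_, fun H => ?_⟩
    · fin_cases j <;> simp
    · have := (H 0).1; simp at this
  · obtain rfl : i = 0 := by omega
    rw [mem_ann, mem_box, mem_box]
    refine ⟨fun j => ?_, fun H => ?_⟩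
    · fin_cases j <;> simp
    · have := (H 0).1; simp at this

/-! ## §10 (v1.3)  «fixing completely a gauge in this set»: the COMPLETE tree gauge fixing, algebraically (p. 196)

p. 196, verbatim: *"We fix the gauge putting the bond variables equal to 1 for bonds belonging to the tree graph. We
use all gauge degrees of freedom connected with points of P₁∖P₂, except one, so we add an external bond to the
graph."* and *"It is a tree graph in 𝔹₀, fixing completely a gauge in this set."*  The ALGEBRAIC content of these two
sentences, for an arbitrary group `G` (a gauge transformation `g` acts on the bond variables by
`V^g(b) = g(b₋) V(b) g(b₊)⁻¹`): EXISTENCE — for every configuration `V` there is a gauge transformation `g`,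
normalized to `1` at the root, with `V^g(b) = 1` for every bond `b` of the tree; UNIQUENESS — two gauge
transformations putting the same `V` to `1` on the tree and agreeing at the root agree on all sites of the tree (the
one unused degree of freedom is the value at the root).  Proved for `T` (root `y`; sites `P₁∖P₂`), for the
single-scale `T₀` of §8 and for the multi-scale `T₀` of §9 (root = the outer end `y − e₁` of the `Λ`-bond, a site
outside `𝔅₀` — so on the sites of `𝔅₀` themselves the gauge is fixed completely).  The measure-level (Faddeev–Popov)
counterpart is `B15TreeGaugeFixing196`. -/

section GaugeFixAbstract

variable {α : Type*} {V : Finset α} {r : α} {p : α → α} {φ : α → ℕ} {G : Type*} [Group G]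

namespace RootedOn

/-- EXISTENCE of a solution of `g z = g (p z) · w z` (`z ∈ V ∖ {r}`) with `g r = 1`: solve down the ranks.
[folklore] -/
private theorem gauge_exists (h : RootedOn V r p φ) (w : α → G) :
    ∃ g : α → G, g r = 1 ∧ ∀ z ∈ V, z ≠ r → g z = g (p z) * w z := by
  classical
  have key : ∀ N : ℕ, ∃ g : α → G, g r = 1 ∧ ∀ z ∈ V, z ≠ r → φ z < N → g z = g (p z) * w z := by
    intro N
    induction N with
    | zero => exact ⟨fun _ => 1, rfl, fun z _ _ hlt => absurd hlt (Nat.not_lt_zero _)⟩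
    | succ N ih =>
      obtain ⟨g, hg1, hg⟩ := ih
      refine ⟨fun z => if z ∈ V ∧ z ≠ r ∧ φ z = N then g (p z) * w z else g z, ?_, ?_⟩
      · have : ¬ (r ∈ V ∧ r ≠ r ∧ φ r = N) := fun H => H.2.1 rfl
        simp only [this, if_false, hg1]
      · intro z hz hzr hlt
        have hp : ¬ (p z ∈ V ∧ p z ≠ r ∧ φ (p z) = N) := by
          rintro ⟨-, -, e⟩
          have := h.rank_lt z hz hzr
          omega
        dsimp only
        by_cases hN : φ z = N
        · rw [if_pos ⟨hz, hzr, hN⟩, if_neg hp]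
        · rw [if_neg (fun H => hN H.2.2), if_neg hp]
          exact hg z hz hzr (by omega)
  obtain ⟨g, hg1, hg⟩ := key (V.sup φ + 1)
  exact ⟨g, hg1, fun z hz hzr => hg z hz hzr (Nat.lt_succ_of_le (Finset.le_sup hz))⟩

/-- UNIQUENESS: two functions with the same bond data `(g (p z))⁻¹ · g z` on `V ∖ {r}` and the same value at the root
agree on `V`: induction on the rank. [folklore] -/
private theorem gauge_unique (h : RootedOn V r p φ) {g g' : α → G}
    (H : ∀ z ∈ V, z ≠ r → (g (p z))⁻¹ * g z = (g' (p z))⁻¹ * g' z) (h0 : g r = g' r) :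
    ∀ z ∈ V, g z = g' z := by
  suffices key : ∀ N : ℕ, ∀ z ∈ V, φ z < N → g z = g' z from
    fun z hz => key (φ z + 1) z hz (Nat.lt_succ_self _)
  intro N
  induction N with
  | zero => intro z _ hlt; exact absurd hlt (Nat.not_lt_zero _)
  | succ N ih =>
    intro z hz hlt
    by_cases hzr : z = r
    · rw [hzr]; exact h0
    · have hpz := ih (p z) (h.parent_mem z hz hzr) (by have := h.rank_lt z hz hzr; omega)
      have e := H z hz hzr
      rw [hpz] at e
      exact mul_left_cancel e

end RootedOn

/-- `x v y⁻¹ = 1 ⇒ x⁻¹ y = v`. [folklore] -/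
private theorem inv_mul_eq_of_fix {x y v : G} (h : x * v * y⁻¹ = 1) : x⁻¹ * y = v := by
  have h1 : x * v = y := mul_inv_eq_one.mp h
  rw [← h1, inv_mul_cancel_left]

/-- `y v x⁻¹ = 1 ⇒ x⁻¹ y = v⁻¹`. [folklore] -/
private theorem inv_mul_eq_inv_of_fix {x y v : G} (h : y * v * x⁻¹ = 1) : x⁻¹ * y = v⁻¹ := by
  have h1 : y * v = x := mul_inv_eq_one.mp h
  rw [← h1, mul_inv_rev, inv_mul_cancel_right]

end GaugeFixAbstract

section GaugeFixTree

variable {l u l' u' : LPt n} {a : ℤ} {G : Type*} [Group G]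

/-- **p. 196, «We fix the gauge putting the bond variables equal to 1 for bonds belonging to the tree graph. We use all
gauge degrees of freedom connected with points of P₁∖P₂, except one»** — EXISTENCE, for any group `G` and any
configuration `V` on the unit bonds: a gauge transformation `g` with `g(y) = 1` and `g(b₋) V(b) g(b₊)⁻¹ = 1` for every
bond `b = ⟨b₋, b₊⟩` of `T`. [cite: Balaban1989LargeFieldI, p.196] -/
theorem tree_gaugeFix_exists (h : Adm l u l' u' a) (V : LBond n → G) :
    ∃ g : LPt n → G, g l = 1 ∧ ∀ b ∈ tree l u l' u' a, g b.1 * V b * (g b.hi)⁻¹ = 1 := by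
  classical
  obtain ⟨g, hg1, hg⟩ := (rooted h).gauge_exists (G := G)
    (fun z => if (pbond l u a z).hi = z then V (pbond l u a z) else (V (pbond l u a z))⁻¹)
  refine ⟨g, hg1, fun b hb => ?_⟩
  obtain ⟨z, hz, hzl, rfl⟩ := exists_pbond_of_mem_tree h hb
  have e := hg z hz hzl
  have hne : par l u a z ≠ z := (rooted h).parent_ne hz hzl
  rcases pbond_ends l u a z with ⟨e1, e2⟩ | ⟨e1, e2⟩
  · rw [if_pos e2] at e
    rw [e1, e2, e]; group
  · have hne' : (pbond l u a z).hi ≠ z := by rw [e2]; exact hne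
    rw [if_neg hne'] at e
    rw [e1, e2, e]; group

/-- **p. 196, «It is a tree graph …, fixing completely a gauge in this set»** — UNIQUENESS for `T`: two gauge
transformations putting the same configuration to `1` on every bond of `T` and agreeing at `y` agree on `P₁∖P₂` (the
one unused degree of freedom is the value at `y`). [cite: Balaban1989LargeFieldI, p.196] -/
theorem tree_gaugeFix_unique (h : Adm l u l' u' a) (V : LBond n → G) {g g' : LPt n → G}
    (hg : ∀ b ∈ tree l u l' u' a, g b.1 * V b * (g b.hi)⁻¹ = 1)
    (hg' : ∀ b ∈ tree l u l' u' a, g' b.1 * V b * (g' b.hi)⁻¹ = 1) (h0 : g l = g' l) :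
    ∀ z ∈ ann l u l' u', g z = g' z := by
  refine (rooted h).gauge_unique (fun z hz hzl => ?_) h0
  have hb := pbond_mem_tree h hz hzl
  have e := hg _ hb
  have e' := hg' _ hb
  rcases pbond_ends l u a z with ⟨e1, e2⟩ | ⟨e1, e2⟩
  · rw [e1, e2] at e e'
    rw [inv_mul_eq_of_fix e, inv_mul_eq_of_fix e']
  · rw [e1, e2] at e e'
    rw [inv_mul_eq_inv_of_fix e, inv_mul_eq_inv_of_fix e']

end GaugeFixTree

section GaugeFixT0

variable {L U : ℕ → LPt n} {A : ℕ → ℤ} {G : Type*} [Group G]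

/-- **p. 196** — EXISTENCE for the single-scale `T₀` of §8: for any group `G` and any configuration `V` there is a
gauge transformation `g`, `g(y − e₁) = 1`, with `g(b₋) V(b) g(b₊)⁻¹ = 1` on every bond of `T₀`.
[cite: Balaban1989LargeFieldI, p.196] -/
theorem T0_gaugeFix_exists {m : ℕ} (h : Chain m L U A) (V : LBond n → G) :
    ∃ g : LPt n → G, g (outRoot L) = 1 ∧ ∀ b ∈ T0 L U A m, g b.1 * V b * (g b.hi)⁻¹ = 1 := by
  classical
  obtain ⟨g, hg1, hg⟩ := (rooted0 h).gauge_exists (G := G)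
    (fun z => if (pb0 L U A m z).hi = z then V (pb0 L U A m z) else (V (pb0 L U A m z))⁻¹)
  refine ⟨g, hg1, fun b hb => ?_⟩
  obtain ⟨z, hz, hzr, rfl⟩ := (mem_T0_iff h b).1 hb
  have e := hg z hz hzr
  have hne : P0 L U A m z ≠ z := (rooted0 h).parent_ne hz hzr
  rcases pb0_joins h z hz hzr with ⟨e1, e2⟩ | ⟨e1, e2⟩
  · rw [if_pos e2] at e
    rw [e1, e2, e]; group
  · have hne' : (pb0 L U A m z).hi ≠ z := by rw [e2]; exact hne
    rw [if_neg hne'] at e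
    rw [e1, e2, e]; group

/-- **p. 196, «fixing completely a gauge in this set»** — UNIQUENESS for the single-scale `T₀`: two gauge
transformations putting the same configuration to `1` on `T₀` and agreeing at the outer end `y − e₁` of the `Λ`-bond
agree on ALL sites of `T₀` (i.e. on the whole of `P^0 ∖ P^m`: the gauge in `𝔅₀` is fixed completely).
[cite: Balaban1989LargeFieldI, p.196] -/
theorem T0_gaugeFix_unique {m : ℕ} (h : Chain m L U A) (V : LBond n → G) {g g' : LPt n → G}
    (hg : ∀ b ∈ T0 L U A m, g b.1 * V b * (g b.hi)⁻¹ = 1)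
    (hg' : ∀ b ∈ T0 L U A m, g' b.1 * V b * (g' b.hi)⁻¹ = 1) (h0 : g (outRoot L) = g' (outRoot L)) :
    ∀ z ∈ sites L U m, g z = g' z := by
  refine (rooted0 h).gauge_unique (fun z hz hzr => ?_) h0
  have hb : pb0 L U A m z ∈ T0 L U A m := (mem_T0_iff h _).2 ⟨z, hz, hzr, rfl⟩
  have e := hg _ hb
  have e' := hg' _ hb
  rcases pb0_joins h z hz hzr with ⟨e1, e2⟩ | ⟨e1, e2⟩
  · rw [e1, e2] at e e'
    rw [inv_mul_eq_of_fix e, inv_mul_eq_of_fix e']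
  · rw [e1, e2] at e e'
    rw [inv_mul_eq_inv_of_fix e, inv_mul_eq_inv_of_fix e']

end GaugeFixT0

section GaugeFixMT0

variable {L U L' U' : ℕ → LPt n} {A : ℕ → ℤ} {uC cC : ℕ → LPt n} {G : Type*} [Group G]

/-- **p. 196** — EXISTENCE for the MULTI-SCALE `T₀` of §9 (bonds recorded as ordered pairs `b = (b₋, b₊)` of tagged
sites): for any group `G` and any configuration `V` there is a gauge transformation `g` on the tagged sites,
`g(y − e₁) = 1`, with `g(b₋) V(b) g(b₊)⁻¹ = 1` on every bond of `T₀`. [cite: Balaban1989LargeFieldI, p.196] -/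
theorem MT0_gaugeFix_exists {m : ℕ} (h : MChain m L U L' U' A uC cC) (V : MPt n × MPt n → G) :
    ∃ g : MPt n → G, g (mroot L) = 1 ∧ ∀ b ∈ MT0 L U L' U' A uC cC m, g b.1 * V b * (g b.2)⁻¹ = 1 := by
  classical
  obtain ⟨g, hg1, hg⟩ := (mrooted h).gauge_exists (G := G)
    (fun x => if pbm L U L' U' A uC cC m x = (MP L U L' U' A uC cC m x, x) then V (pbm L U L' U' A uC cC m x)
      else (V (pbm L U L' U' A uC cC m x))⁻¹)
  refine ⟨g, hg1, fun b hb => ?_⟩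
  obtain ⟨x, hx, hxr, rfl⟩ := (mem_MT0_iff h b).1 hb
  have e := hg x hx hxr
  have hne : MP L U L' U' A uC cC m x ≠ x := (mrooted h).parent_ne hx hxr
  rcases pbm_joins h x hx hxr with e' | e'
  · rw [if_pos e', e'] at e
    rw [e', e]; group
  · have hne' : pbm L U L' U' A uC cC m x ≠ (MP L U L' U' A uC cC m x, x) := by
      rw [e']; intro H; exact hne (Prod.mk.inj H).1.symm
    rw [if_neg hne', e'] at e
    rw [e', e]; group

/-- **p. 196, «It is a tree graph in 𝔹₀, fixing completely a gauge in this set»** — UNIQUENESS for the multi-scale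
`T₀`: two gauge transformations on the tagged sites putting the same configuration to `1` on `T₀` and agreeing at the
outer end `y − e₁` of the `Λ`-bond agree on ALL sites, i.e. on every layer `P^i ∖ P^{i+1}` — the gauge in `𝔅₀` is fixed
completely, the single unused degree of freedom sitting outside `𝔅₀`. [cite: Balaban1989LargeFieldI, p.196] -/
theorem MT0_gaugeFix_unique {m : ℕ} (h : MChain m L U L' U' A uC cC) (V : MPt n × MPt n → G) {g g' : MPt n → G}
    (hg : ∀ b ∈ MT0 L U L' U' A uC cC m, g b.1 * V b * (g b.2)⁻¹ = 1)
    (hg' : ∀ b ∈ MT0 L U L' U' A uC cC m, g' b.1 * V b * (g' b.2)⁻¹ = 1) (h0 : g (mroot L) = g' (mroot L)) :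
    ∀ x ∈ msites L U L' U' m, g x = g' x := by
  refine (mrooted h).gauge_unique (fun x hx hxr => ?_) h0
  have hb : pbm L U L' U' A uC cC m x ∈ MT0 L U L' U' A uC cC m := (mem_MT0_iff h _).2 ⟨x, hx, hxr, rfl⟩
  have e := hg _ hb
  have e' := hg' _ hb
  rcases pbm_joins h x hx hxr with e1 | e1
  · rw [e1] at e e'
    exact (inv_mul_eq_of_fix e).trans (inv_mul_eq_of_fix e').symm
  · rw [e1] at e e'
    exact (inv_mul_eq_inv_of_fix e).trans (inv_mul_eq_inv_of_fix e').symm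

end GaugeFixMT0

end Literature.MathematicalPhysics.QuantumFieldTheory.Balaban1983to89.B15TreeGraph196
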